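import Literature.Geometry.Riemannian.ShrinkerEntropy
import Literature.Geometry.Riemannian.PerelmanEntropyCutoff
import Literature.Geometry.Lorentzian.DalembertianCompose
import Literature.Geometry.Lorentzian.GreenIdentityCompactSupport
import Literature.Geometry.Lorentzian.CurvatureRegularity
import Literature.Geometry.Riemannian.GradientEstimateIntegration
import Mathlib.Analysis.SpecialFunctions.SmoothTransition
import HarnessLib

/-!
# Carrillo–Ni 2009: the proved layer of the shrinker LSI (§2 (2.1)–(2.3), §4; closed case;
# Green's identity with a proper exhaustion; Thm. 1.1 (i) from properness of `f`; the upper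
# bound of Lemma 2.1 from `S ≥ −B`; the reductions of clauses (ii), (iii) to
# properness / [Ch] / Thm. 3.1)

Sibling proof file of `ShrinkerEntropy.lean` (named fact `CarrilloNi2009_shrinkerLSI`: Thm. 1.1
(i)–(ii) of J. A. Carrillo, L. Ni, *Sharp logarithmic Sobolev inequalities on gradient solitons
and applications*, Comm. Anal. Geom. 17 (2009) 721–753 = arXiv:0806.2417, in the bounded second
moment form of §4, with the sharpness clause, at `τ = 1`). Everything here is proved; no
definitions and no named facts are introduced (D-0026).

## What is proved, and what is not

The printed proof (arXiv text, §§2–4) combines three analytic inputs, two of which the tree cannot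
supply yet on a complete NONCOMPACT manifold —
* Lemma 2.1 / Cor. 2.1 (p. 5): quadratic growth of `f` (so `f` is proper) and
  `∫ (|Δf| + |∇f|² + |f| + S) e^{-f} dΓ < ∞`, after Chen's `S ≥ 0` [Ch], Fang–Man–Zhang [FMZ] /
  Cao–Zhou [CZh] (second variation along minimal geodesics of the complete metric) and the
  weighted volume comparison of Wei–Wylie [WW] — the PROPERNESS of `f` (the lower bound
  `f ≥ (r − C₁)²/4`, second variation) and `S ≥ 0` (maximum principle at infinity) are NOT
  available, but everything else is PROVED from them below: the upper bound of Lemma 2.1 in the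
  form `f + B + 1 ≤ 2 (f(o) + B + 1) + d(o, ·)²/2` from `S ≥ −B` (`√(f + B + 1)` is
  `½`-Lipschitz: `|∇f|² = f − S ≤ f + B`, Cauchy–Schwarz, and integration of the differential
  bound along almost-minimising curves, `ofReal_abs_sub_le_mul_riemEDist` — no geodesics), and
  the content of Cor. 2.1 (`integrable_exp_neg_of_proper`: `e^{-f}, f e^{-f} ∈ L¹` from
  properness alone, by the cut-off weighted-volume inequality `∫ φ(f/R)(f − n/2)e^{-f} ≤ 0` and
  Fatou — no comparison geometry; `integrable_gradSq_mul_exp_neg_of_proper`: `S e^{-f},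
  |∇f|² e^{-f} ∈ L¹` once `S` is bounded below; `integrable_potential_mul_of_secondMoment`:
  `f u, S u ∈ L¹` for densities of bounded second moment);
* Thm. 3.1 (p. 7): the Bakry–Émery / HWI logarithmic Sobolev inequality
  `H_V(ρ) ≤ I_V(ρ)/(2K)` of a `C(K, ∞)` weighted complete manifold, `K > 0`, for densities of
  bounded second moment (after Villani, *Optimal transport, old and new*) — NOT available (no
  optimal transport / `Γ₂`-calculus on manifolds);
* the integrations by parts of §4 (p. 9) on a complete manifold (`∫ ⟨∇f, ∇ρ⟩ = −∫ ρ Δf`,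
  `∫ Δ(e^{-f}) = 0`) — PROVED here in the form needed for the sharpness clause, as the cut-off
  lemma `integral_dalembertian_eq_zero_of_proper` (`∫_M Δ_g w dV_g = 0` whenever `M` carries a
  proper smooth `ρ` and `Δw`, `g⁻¹(dρ, dw)` are integrable: Green's first identity with compact
  support, `GreenIdentityCompactSupport.lean`, for the cut-offs `φ(ρ/R)`, `φ = 1 − smoothTransition
  (· − 1)`, and dominated convergence),
— with an algebraic layer, proved below in the namespace `CarrilloNi2009_shrinkerLSI`, and the
resulting REDUCTIONS of the clauses of the fact to the two missing inputs
(`wEntropy_add_log_eq_of_proper`, `muEntropy_le_log_of_proper`: Thm. 1.1 (i) normalisation and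
the sharpness clause (iii), hence `μ(g, 1) ≤ log Θ`, on a complete shrinker GIVEN that `f` is
proper and `e^{-f}`, `f e^{-f}`, `|∇f|² e^{-f}` are integrable — Lemma 2.1 / Cor. 2.1;
`log_le_wEntropy_of_lsi`: clause (ii) for a smooth unit-mass density `u = (4π)^{-n/2} e^{-ψ}`
GIVEN the LSI of Thm. 3.1 for this `u`, `∫ (f + log Θ − ψ) u ≤ ∫ |∇(f − ψ)|² u`, the integration
by parts `∫ g⁻¹(df, dψ) u = ∫ u Δf`, and the integrability of `f u`, `ψ u`, `S u`, `|∇ψ|² u`,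
`g⁻¹(df, dψ) u` — the computation "`I_V(ρ) = ∫ [|∇ψ|² + S + (f + μ_s − n)/τ] ρ`" of p. 9):
* `scalarCurvature_add_dalembertian` — (2.1) at `τ = 1`: `S + Δf = n/2`, the metric trace of
  the soliton equation `Ric + Hess f = g/2`;
* `two_mul_dalembertian_identity` — (2.3) for the tree's normalisation `S + |∇f|² = f`
  (i.e. (2.2) at `τ = 1` with `μ_s(1) = 0`): `2Δf − |∇f|² + S + f − n = 0`;
* `dalembertian_exp_neg` — `Δ(e^{-f}) = (f − n/2) e^{-f}`, so that the sharpness clause (iii)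
  is the vanishing of `∫_M Δ(e^{-f}) dV`;
* `isEntropyCompatible_add_log` — Thm. 1.1 (i), second half: an integrable potential "can be
  normalized", `∫ (4π)^{-n/2} e^{-(f + log Θ)} dV = 1`, `Θ = (4π)^{-n/2} ∫ e^{-f} dV > 0`
  (`theta_pos`);
* `wEntropy_add_log_eq` — §4, "`u = e^{-f}/(4πτ)^{n/2}` is the minimizer": `𝒲(g, f + log Θ, 1)
  = log Θ` as soon as `e^{-f}` and `f e^{-f}` are integrable and `∫ (2f − n) e^{-f} dV = 0`;
* `wEntropy_add_log_eq_of_compactSpace`, `muEntropy_le_log_of_compactSpace` — on a CLOSED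
  gradient shrinker these provisos hold (finite volume; `∫ Δu dV = 0` by Green's identity,
  `integral_dalembertian_eq_zero` of `GreenIdentity.lean`), so clauses (i) and (iii) of the fact,
  and `μ(g, 1) ≤ log Θ`, hold there unconditionally.
* `integral_dalembertian_eq_zero_of_proper`, `wEntropy_add_log_eq_of_proper`,
  `muEntropy_le_log_of_proper` — the cut-off lemma and, through it, clauses (i) (normalisation)
  and (iii) and `μ(g, 1) ≤ log Θ` on a complete shrinker whose potential is proper with `e^{-f}`,
  `f e^{-f}`, `|∇f|² e^{-f}` integrable (the content of Lemma 2.1 / Cor. 2.1);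
* `gradSq_sub`, `log_le_wEntropy_of_lsi` — the §4 passage from `H_V ≤ I_V` to the `𝒲`-form,
  i.e. clause (ii) for each smooth unit-mass density granted Thm. 3.1 and the integration by parts
  for that density;
* `integral_mul_dalembertian_eq_neg_integral_innerDual_of_proper` — Green's first identity
  `∫ u Δw dV = −∫ g⁻¹(du, dw) dV` on a manifold with a proper smooth exhaustion (`u ∈ C¹`,
  `w ∈ C²`, `u Δw`, `g⁻¹(du, dw)`, `u g⁻¹(dρ, dw)` integrable), by the same cut-offs and the
  Leibniz rule; `integral_innerDual_mul_density_eq` — hence the integration by parts of §4,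
  `∫ g⁻¹(df, dψ) u = ∫ u Δf`, for a smooth density `u` with `u`, `S u`, `f u`, `g⁻¹(df, dψ) u`
  integrable; `log_le_wEntropy_of_lsi_of_proper` — clause (ii) for such a density granted only
  the LSI of Thm. 3.1 for it.
* `integral_cutoff_mul_sub_mul_exp_neg_nonpos`, `integrable_exp_neg_of_proper`,
  `clause_i_of_proper`, `integrable_gradSq_mul_exp_neg_of_proper`, `clauses_i_iii_of_proper` —
  the weighted-volume inequality, Thm. 1.1 (i) (integrability AND normalisation of `e^{-f}`) on a
  shrinker with proper potential, and clauses (i) + (iii) + `μ(g, 1) ≤ log Θ` on a shrinker with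
  proper potential and scalar curvature bounded below (`integrable_of_forall_integral_cutoff_mul_le`
  is the Fatou step).
* `riemEDist_lt_top`, `ofReal_abs_sqrt_sub_sqrt_le`, `potential_le_of_scalarCurvature_ge`,
  `integrable_potential_mul_of_secondMoment`, `abs_innerDual_mvfderiv_le`, `clause_ii_of_lsi` —
  finiteness of the distance on a connected manifold, the Lipschitz bound for `√(f + B + 1)` and
  the quadratic upper growth bound of Lemma 2.1 from `S ≥ −B`, the resulting integrability of
  `f u`, `S u` for densities of bounded second moment, Cauchy–Schwarz for `g⁻¹`, and CLAUSE (ii)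
  for every smooth compatible `ψ` of bounded second moment with integrable `𝒲`-integrand and
  integrable `|∇ψ|² u`, granted only the LSI of Thm. 3.1 for that density (plus properness of `f`
  and `S ≥ −B`).
What remains for `CarrilloNi2009_shrinkerLSI_holds` is exactly, on a complete noncompact shrinker:
(a) the properness of `f` (the lower bound `f ≥ (r − C₁)²/4` of Lemma 2.1, [FMZ]/[CZh]: second
variation along minimal geodesics); (b) a lower bound for `S` (Chen's `S ≥ 0`, [Ch]: maximum
principle at infinity) — (a), (b) give clauses (i), (iii) by `clauses_i_iii_of_proper`; (c) the LSI
of Thm. 3.1 itself, `∫ (f + log Θ − ψ) u ≤ ∫ |∇(f − ψ)|² u` (Bakry–Émery / HWI on the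
`C(½, ∞)` space `(M, g, Θ⁻¹(4π)^{-n/2} e^{-f} dV)`), which gives clause (ii) by `clause_ii_of_lsi`
for densities with `|∇ψ|² u ∈ L¹`; and (d) the remaining case `|∇ψ|² u ∉ L¹` of clause (ii)
(integrable `𝒲`-integrand but infinite Fisher information), where the printed LSI is vacuous.

## References

* [CarrilloNi2009] J. A. Carrillo, L. Ni, Comm. Anal. Geom. 17 (2009) 721–753
  (arXiv:0806.2417): Thm. 1.1, §2 (2.1)–(2.3), Lemma 2.1, Cor. 2.1, Thm. 3.1, §4, Cor. 4.1
  (held; read pp. 3–10 of the arXiv text).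
* [Lee2018] J. M. Lee, *Introduction to Riemannian Manifolds*, 2nd ed., Springer 2018,
  Problem 2-23 (c) (`∫ Δu dV = 0` on a closed manifold).
-/

noncomputable section

open Bundle Set Module Filter MeasureTheory Manifold
open scoped ContDiff Topology ENNReal NNReal

namespace Literature.Geometry.Riemannian

open Lorentzian

namespace CarrilloNi2009_shrinkerLSI

section TraceIdentities

variable {n : ℕ} {M : Type*} [TopologicalSpace M] [ChartedSpace (EuclideanSpace ℝ (Fin n)) M]
  [IsManifold (𝓡 n) ∞ M]
  {g : PseudoRiemannianMetric (𝓡 n) ∞ (EuclideanSpace ℝ (Fin n)) (TangentSpace (𝓡 n) : M → Type _)}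
  {f : M → ℝ}

/-- `|∇(f + c)|² = |∇f|²` at a point of differentiability (chain rule with `t ↦ t + c`).
[folklore] -/
theorem gradSq_add_const (c : ℝ) {x : M} (hfx : MDifferentiableAt (𝓡 n) 𝓘(ℝ, ℝ) f x) :
    g.gradSq (fun y ↦ f y + c) x = g.gradSq f x := by
  have hh : HasDerivAt (fun t : ℝ ↦ t + c) 1 (f x) := (hasDerivAt_id (f x)).add_const c
  have := g.gradSq_real_comp (h := fun t : ℝ ↦ t + c) hh hfx
  rw [show (fun y ↦ f y + c) = (fun t : ℝ ↦ t + c) ∘ f from rfl, this, one_pow, one_mul]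

variable [g.HasLeviCivita]

/-- **(2.1) at `τ = 1`: `S + Δf = n/2`** on a gradient shrinking soliton `Ric + Hess f = g/2` —
the metric trace of the soliton equation (`tr_g Ric = S`, `tr_g Hess f = Δf = □_g f`,
`tr_g g = n`). [cite: CarrilloNi2009, §2, (2.1)] -/
theorem scalarCurvature_add_dalembertian
    (hsol : ∀ (x : M) (X Y : TangentSpace (𝓡 n) x),
      g.ricci x X Y + g.hessian f x X Y = (1 / 2 : ℝ) * g.val x X Y) (x : M) :
    g.scalarCurvature x + g.dalembertian f x = (n : ℝ) / 2 := by
  have hform : g.ricci x + g.hessian f x = (1 / 2 : ℝ) • g.toBilinForm x := by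
    refine LinearMap.ext₂ fun X Y ↦ ?_
    simpa using hsol x X Y
  have htr := congrArg (g.trace x) hform
  rw [PseudoRiemannianMetric.trace_add, PseudoRiemannianMetric.trace_smul,
    PseudoRiemannianMetric.trace_toBilinForm_eq, finrank_euclideanSpace_fin] at htr
  rw [PseudoRiemannianMetric.scalarCurvature, PseudoRiemannianMetric.dalembertian, htr]
  ring

/-- **(2.3) with `μ_s = 0`: `2Δf − |∇f|² + S + f − n = 0`** for a gradient shrinker normalised by
`S + |∇f|² = f` (the tree's normalisation, i.e. (2.2) at `τ = 1` with `μ_s(1) = 0`), from (2.1).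
[cite: CarrilloNi2009, §2, (2.2)–(2.3)] -/
theorem two_mul_dalembertian_identity
    (hsol : ∀ (x : M) (X Y : TangentSpace (𝓡 n) x),
      g.ricci x X Y + g.hessian f x X Y = (1 / 2 : ℝ) * g.val x X Y)
    (hnorm : ∀ x : M, g.scalarCurvature x + g.gradSq f x = f x) (x : M) :
    2 * g.dalembertian f x - g.gradSq f x + g.scalarCurvature x + f x - n = 0 := by
  have h1 := scalarCurvature_add_dalembertian hsol x
  have h2 := hnorm x
  linarith

/-- **`Δ(e^{-f}) = (f − n/2) e^{-f}`** on a gradient shrinker normalised by `S + |∇f|² = f`: by the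
chain rule `Δ(ζ ∘ f) = ζ''(f)|∇f|² + ζ'(f) Δf` (`dalembertian_real_comp`) with `ζ = e^{-·}`,
`Δ(e^{-f}) = (|∇f|² − Δf) e^{-f}`, and `|∇f|² − Δf = (f − S) − (n/2 − S)` by (2.1)–(2.2). This is
the pointwise identity behind "`u = e^{-f}/(4πτ)^{n/2}` is the minimizer" (§4): the sharpness
clause is `∫ Δ(e^{-f}) dV = 0`. [cite: CarrilloNi2009, §2 (2.1)–(2.3) and §4] -/
theorem dalembertian_exp_neg
    (hsol : ∀ (x : M) (X Y : TangentSpace (𝓡 n) x),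
      g.ricci x X Y + g.hessian f x X Y = (1 / 2 : ℝ) * g.val x X Y)
    (hnorm : ∀ x : M, g.scalarCurvature x + g.gradSq f x = f x)
    (hf : ContMDiff (𝓡 n) 𝓘(ℝ, ℝ) ∞ f) (x : M) :
    g.dalembertian (fun y ↦ Real.exp (-f y)) x = (f x - n / 2) * Real.exp (-f x) := by
  have hfx : ContMDiffAt (𝓡 n) 𝓘(ℝ, ℝ) 2 f x := (hf.of_le ENat.LEInfty.out).contMDiffAt
  have hζ : ContDiffAt ℝ 2 (fun t : ℝ ↦ Real.exp (-t)) (f x) :=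
    (Real.contDiff_exp.comp contDiff_neg).contDiffAt
  have hd : ∀ t : ℝ, HasDerivAt (fun s : ℝ ↦ Real.exp (-s)) (-Real.exp (-t)) t := fun t ↦ by
    simpa using (hasDerivAt_neg t).exp
  have hd1 : deriv (fun s : ℝ ↦ Real.exp (-s)) = fun t ↦ -Real.exp (-t) :=
    funext fun t ↦ (hd t).deriv
  have hd2 : deriv (deriv fun s : ℝ ↦ Real.exp (-s)) (f x) = Real.exp (-f x) := by
    rw [hd1]
    simpa using (hd (f x)).neg.deriv
  have hcomp := g.dalembertian_real_comp (ζ := fun t : ℝ ↦ Real.exp (-t)) hfx hζ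
  rw [show (fun y ↦ Real.exp (-f y)) = (fun t : ℝ ↦ Real.exp (-t)) ∘ f from rfl, hcomp, hd2,
    (hd (f x)).deriv]
  have hgrad : g.innerDual x (mvfderiv (𝓡 n) f x).toLinearMap (mvfderiv (𝓡 n) f x).toLinearMap =
      g.gradSq f x := rfl
  rw [hgrad]
  have h1 := scalarCurvature_add_dalembertian hsol x
  have h2 := hnorm x
  have h3 : g.gradSq f x - g.dalembertian f x = f x - n / 2 := by linarith
  rw [← h3]
  ring

end TraceIdentities

section Normalisation

variable {n : ℕ} {M : Type*} [TopologicalSpace M] [ChartedSpace (EuclideanSpace ℝ (Fin n)) M]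
  [IsManifold (𝓡 n) ∞ M] [T3Space M] [MeasurableSpace M] [BorelSpace M]
  {g : PseudoRiemannianMetric (𝓡 n) ∞ (EuclideanSpace ℝ (Fin n)) (TangentSpace (𝓡 n) : M → Type _)}
  {f : M → ℝ}

/-- **`Θ = (4π)^{-n/2} ∫_M e^{-f} dV > 0`** for an integrable potential on a nonempty Riemannian
manifold (`e^{-f} > 0` and `Vol(M) > 0`, `riemVolume_univ_pos`). [folklore] -/
theorem theta_pos [Nonempty M] (hg : g.IsRiemannian)
    (hint : Integrable (fun x ↦ Real.exp (-f x)) g.riemVolume) :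
    0 < (4 * Real.pi) ^ (-(n : ℝ) / 2) * ∫ x, Real.exp (-f x) ∂g.riemVolume := by
  have hA : 0 < (4 * Real.pi) ^ (-(n : ℝ) / 2) := Real.rpow_pos_of_pos (by positivity) _
  haveI : NeZero g.riemVolume := ⟨fun h0 ↦ by
    have hpos := PseudoRiemannianMetric.riemVolume_univ_pos (I := 𝓡 n) (M := M) hg
    rw [h0] at hpos
    simp at hpos⟩
  exact mul_pos hA (integral_exp_pos hint)

/-- The density of the shifted potential: `(4π)^{-n/2} e^{-(f + log Θ)} = Θ⁻¹ · (4π)^{-n/2} e^{-f}`.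
[folklore] -/
theorem entropyDensity_add_log [Nonempty M] (hg : g.IsRiemannian)
    (hint : Integrable (fun x ↦ Real.exp (-f x)) g.riemVolume) (x : M) :
    entropyDensity n (fun y ↦ f y +
        Real.log ((4 * Real.pi) ^ (-(n : ℝ) / 2) * ∫ x, Real.exp (-f x) ∂g.riemVolume)) 1 x =
      ((4 * Real.pi) ^ (-(n : ℝ) / 2) * ∫ x, Real.exp (-f x) ∂g.riemVolume)⁻¹ *
        ((4 * Real.pi) ^ (-(n : ℝ) / 2) * Real.exp (-f x)) := by
  rw [entropyDensity_apply, mul_one, neg_add, Real.exp_add, Real.exp_neg (Real.log _),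
    Real.exp_log (theta_pos hg hint)]
  ring

/-- **Thm. 1.1 (i), normalisation**: if the potential `e^{-f}` is integrable then "it can be
normalized": the shift `f + log Θ`, `Θ = (4π)^{-n/2} ∫ e^{-f} dV`, is compatible at `τ = 1`,
`∫_M (4π)^{-n/2} e^{-(f + log Θ)} dV = 1`. [cite: CarrilloNi2009, Thm. 1.1 (i)] -/
theorem isEntropyCompatible_add_log [Nonempty M] (hg : g.IsRiemannian)
    (hint : Integrable (fun x ↦ Real.exp (-f x)) g.riemVolume) :
    g.IsEntropyCompatible (fun y ↦ f y +
      Real.log ((4 * Real.pi) ^ (-(n : ℝ) / 2) * ∫ x, Real.exp (-f x) ∂g.riemVolume)) 1 := by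
  have hΘ := theta_pos hg hint
  rw [PseudoRiemannianMetric.isEntropyCompatible_iff, finrank_euclideanSpace_fin]
  simp_rw [entropyDensity_add_log hg hint]
  rw [integral_const_mul, integral_const_mul, inv_mul_cancel₀ hΘ.ne']

variable [g.HasLeviCivita]

/-- **§4, sharpness ("`u = e^{-f}/(4πτ)^{n/2}` is the minimizer for Perelman's `μ(g, τ)`")**, at
`τ = 1`, reduced to its analytic provisos: for a Riemannian `g` and a smooth `f` with
`S + |∇f|² = f`, if `e^{-f}` and `f e^{-f}` are integrable and `∫_M (2f − n) e^{-f} dV = 0`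
(i.e. `∫ Δ(e^{-f}) dV = 0`, `dalembertian_exp_neg`), then `𝒲(g, f + log Θ, 1) = log Θ`:
the `𝒲`-integrand of `f + log Θ` is `(2f + log Θ − n) u`, `u = Θ⁻¹ (4π)^{-n/2} e^{-f}` of unit
mass. [cite: CarrilloNi2009, §4 (sharpness; Cor. 4.1)] -/
theorem wEntropy_add_log_eq [Nonempty M] (hg : g.IsRiemannian) (hf : ContMDiff (𝓡 n) 𝓘(ℝ, ℝ) ∞ f)
    (hnorm : ∀ x : M, g.scalarCurvature x + g.gradSq f x = f x)
    (hint : Integrable (fun x ↦ Real.exp (-f x)) g.riemVolume)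
    (hfint : Integrable (fun x ↦ f x * Real.exp (-f x)) g.riemVolume)
    (hdiv : ∫ x, (2 * f x - n) * Real.exp (-f x) ∂g.riemVolume = 0) :
    g.wEntropy g.leviCivita (fun y ↦ f y +
        Real.log ((4 * Real.pi) ^ (-(n : ℝ) / 2) * ∫ x, Real.exp (-f x) ∂g.riemVolume)) 1 =
      Real.log ((4 * Real.pi) ^ (-(n : ℝ) / 2) * ∫ x, Real.exp (-f x) ∂g.riemVolume) := by
  have hdens := entropyDensity_add_log hg hint
  have hcompat := isEntropyCompatible_add_log (g := g) hg hint
  rw [PseudoRiemannianMetric.isEntropyCompatible_iff, finrank_euclideanSpace_fin] at hcompat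
  set Θ : ℝ := (4 * Real.pi) ^ (-(n : ℝ) / 2) * ∫ x, Real.exp (-f x) ∂g.riemVolume with hΘdef
  have hu : Integrable (entropyDensity n (fun y ↦ f y + Real.log Θ) 1) g.riemVolume := by
    by_contra hni
    rw [integral_undef hni] at hcompat
    exact zero_ne_one hcompat
  have hI : Integrable (fun x ↦ (2 * f x - n) * Real.exp (-f x)) g.riemVolume :=
    ((hfint.const_mul 2).sub (hint.const_mul (n : ℝ))).congr
      (Eventually.of_forall fun x ↦ by simp only [Pi.sub_apply]; ring)
  rw [PseudoRiemannianMetric.wEntropy_def, finrank_euclideanSpace_fin]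
  have hpt : ∀ x, (1 * (g.scalarCurvatureWith g.leviCivita x +
      g.gradSq (fun y ↦ f y + Real.log Θ) x) + (f x + Real.log Θ) - (n : ℕ)) *
        entropyDensity n (fun y ↦ f y + Real.log Θ) 1 x =
      Θ⁻¹ * (4 * Real.pi) ^ (-(n : ℝ) / 2) * ((2 * f x - n) * Real.exp (-f x)) +
        Real.log Θ * entropyDensity n (fun y ↦ f y + Real.log Θ) 1 x := by
    intro x
    rw [PseudoRiemannianMetric.scalarCurvatureWith_leviCivita,
      gradSq_add_const _ (hf.mdifferentiableAt (by norm_num)), hnorm x, hdens x]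
    ring
  simp_rw [hpt]
  rw [integral_add (hI.const_mul _) (hu.const_mul _), integral_const_mul, integral_const_mul, hdiv,
    hcompat]
  ring

end Normalisation

section Closed

variable {n : ℕ} {M : Type*} [TopologicalSpace M] [ChartedSpace (EuclideanSpace ℝ (Fin n)) M]
  [IsManifold (𝓡 n) ∞ M] [T2Space M] [CompactSpace M] [MeasurableSpace M] [BorelSpace M]
  {g : PseudoRiemannianMetric (𝓡 n) ∞ (EuclideanSpace ℝ (Fin n)) (TangentSpace (𝓡 n) : M → Type _)}
  {f : M → ℝ}

/-- **Thm. 1.1 (i) on a closed manifold**: `e^{-f}` is integrable for `dV_g` (continuous, finite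
volume). [cite: CarrilloNi2009, Thm. 1.1 (i)] -/
theorem integrable_exp_neg_of_compactSpace (hf : ContMDiff (𝓡 n) 𝓘(ℝ, ℝ) ∞ f) :
    Integrable (fun x ↦ Real.exp (-f x)) g.riemVolume :=
  g.integrable_of_continuous (Real.continuous_exp.comp hf.continuous.neg)

variable [g.HasLeviCivita]

/-- **`∫_M Δ_g u dV_g = 0` on a closed Riemannian manifold**, `u ∈ C²` (Green's identity with
`1`; the tree's `integral_dalembertian_eq_zero` for the Mathlib metric `g.toContMDiffRiemannianMetric`,
whose `ofRiemannian` is `g` and whose Riemannian measure is `g.riemVolume`). [cite: Lee2018, Problem 2-23 (c)] -/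
theorem integral_dalembertian_eq_zero_of_compactSpace (hg : g.IsRiemannian) {u : M → ℝ}
    (hu : ContMDiff (𝓡 n) 𝓘(ℝ, ℝ) 2 u) : ∫ x, g.dalembertian u x ∂g.riemVolume = 0 := by
  haveI := (PseudoRiemannianMetric.ofRiemannian (g.toContMDiffRiemannianMetric hg)).hasLeviCivita
  have h1 := integral_dalembertian_eq_zero (g.toContMDiffRiemannianMetric hg) hu
  rw [PseudoRiemannianMetric.riemVolume_eq hg]
  exact h1

/-- **Sharpness on a closed gradient shrinker** (§4, "`u = e^{-f}/(4πτ)^{n/2}` is the minimizer";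
Cor. 4.1 `μ(g, 1) = −μ_s` with `−μ_s = log Θ` for the tree's normalisation): for `g` Riemannian on a
closed manifold and `f` smooth with `Ric + Hess f = g/2`, `S + |∇f|² = f`,
`𝒲(g, f + log Θ, 1) = log Θ` — unconditionally, the provisos of `wEntropy_add_log_eq` being
finite volume and `∫ Δ(e^{-f}) dV = 0` (`dalembertian_exp_neg`, Green).
[cite: CarrilloNi2009, §4, Cor. 4.1 (closed case)] -/
theorem wEntropy_add_log_eq_of_compactSpace [Nonempty M] (hg : g.IsRiemannian)
    (hf : ContMDiff (𝓡 n) 𝓘(ℝ, ℝ) ∞ f)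
    (hsol : ∀ (x : M) (X Y : TangentSpace (𝓡 n) x),
      g.ricci x X Y + g.hessian f x X Y = (1 / 2 : ℝ) * g.val x X Y)
    (hnorm : ∀ x : M, g.scalarCurvature x + g.gradSq f x = f x) :
    g.wEntropy g.leviCivita (fun y ↦ f y +
        Real.log ((4 * Real.pi) ^ (-(n : ℝ) / 2) * ∫ x, Real.exp (-f x) ∂g.riemVolume)) 1 =
      Real.log ((4 * Real.pi) ^ (-(n : ℝ) / 2) * ∫ x, Real.exp (-f x) ∂g.riemVolume) := by
  have hint : Integrable (fun x ↦ Real.exp (-f x)) g.riemVolume :=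
    integrable_exp_neg_of_compactSpace hf
  have hfint : Integrable (fun x ↦ f x * Real.exp (-f x)) g.riemVolume :=
    g.integrable_of_continuous (hf.continuous.mul (Real.continuous_exp.comp hf.continuous.neg))
  refine wEntropy_add_log_eq hg hf hnorm hint hfint ?_
  have h2 : ContMDiff (𝓡 n) 𝓘(ℝ, ℝ) 2 (fun y ↦ Real.exp (-f y)) :=
    ((Real.contDiff_exp.comp contDiff_neg).comp_contMDiff hf).of_le ENat.LEInfty.out
  have h0 := integral_dalembertian_eq_zero_of_compactSpace hg h2
  simp_rw [dalembertian_exp_neg hsol hnorm hf] at h0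
  have h3 : ∀ x, (2 * f x - n) * Real.exp (-f x) = 2 * ((f x - n / 2) * Real.exp (-f x)) :=
    fun x ↦ by ring
  simp_rw [h3]
  rw [integral_const_mul, h0, mul_zero]

/-- **`μ(g, 1) ≤ log Θ` on a closed gradient shrinker, unconditionally** (`Θ = (4π)^{-n/2}
∫ e^{-f} dV`): the compatible shift `f + log Θ` is admissible (Thm. 1.1 (i)) and
`𝒲(g, f + log Θ, 1) = log Θ` (sharpness), so `muEntropy_le` applies. (On a closed manifold
Perelman's `μ(g, 1)` equals `−μ_s = log Θ` by Cor. 4.1; the reverse inequality is the LSI,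
clause (ii), not proved here.) [cite: CarrilloNi2009, Thm. 1.1 (i)–(ii) and Cor. 4.1 (closed case)] -/
theorem muEntropy_le_log_of_compactSpace [Nonempty M] (hg : g.IsRiemannian)
    (hf : ContMDiff (𝓡 n) 𝓘(ℝ, ℝ) ∞ f)
    (hsol : ∀ (x : M) (X Y : TangentSpace (𝓡 n) x),
      g.ricci x X Y + g.hessian f x X Y = (1 / 2 : ℝ) * g.val x X Y)
    (hnorm : ∀ x : M, g.scalarCurvature x + g.gradSq f x = f x) :
    g.muEntropy g.leviCivita 1 ≤
      ((Real.log ((4 * Real.pi) ^ (-(n : ℝ) / 2) * ∫ x, Real.exp (-f x) ∂g.riemVolume) : ℝ) :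
        EReal) := by
  have hcompat := isEntropyCompatible_add_log hg (integrable_exp_neg_of_compactSpace (g := g) hf)
  have hsmooth : ContMDiff (𝓡 n) 𝓘(ℝ, ℝ) ∞ fun y ↦ f y +
      Real.log ((4 * Real.pi) ^ (-(n : ℝ) / 2) * ∫ x, Real.exp (-f x) ∂g.riemVolume) :=
    hf.add contMDiff_const
  have hle := PseudoRiemannianMetric.muEntropy_le (cov := g.leviCivita) hsmooth hcompat
  rwa [wEntropy_add_log_eq_of_compactSpace hg hf hsol hnorm] at hle

end Closed

section Exhaustion

variable {n : ℕ} {M : Type*} [TopologicalSpace M] [ChartedSpace (EuclideanSpace ℝ (Fin n)) M]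
  [IsManifold (𝓡 n) ∞ M] [T2Space M] [T3Space M] [MeasurableSpace M] [BorelSpace M]
  {g : PseudoRiemannianMetric (𝓡 n) ∞ (EuclideanSpace ℝ (Fin n)) (TangentSpace (𝓡 n) : M → Type _)}
  [g.HasLeviCivita] {f : M → ℝ}

/-- A smooth cut-off profile on `ℝ`: `cutoffProfile t = 1 − smoothTransition (t − 1)` equals `1`
for `t ≤ 1`, `0` for `t ≥ 2`, takes values in `[0, 1]`, is `C^∞` and has a bounded derivative
supported in `[1, 2]`. [folklore] -/
theorem exists_cutoffProfile :
    ∃ φ : ℝ → ℝ, ContDiff ℝ ∞ φ ∧ (∀ t ≤ 1, φ t = 1) ∧ (∀ t, 2 ≤ t → φ t = 0) ∧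
      (∀ t, 0 ≤ φ t ∧ φ t ≤ 1) ∧ ∃ C : ℝ, ∀ t, |deriv φ t| ≤ C := by
  refine ⟨fun t ↦ 1 - Real.smoothTransition (t - 1), ?_, ?_, ?_, ?_, ?_⟩
  · exact contDiff_const.sub (Real.smoothTransition.contDiff.comp (contDiff_id.sub contDiff_const))
  · intro t ht
    simp [Real.smoothTransition.zero_of_nonpos (by linarith : t - 1 ≤ 0)]
  · intro t ht
    simp [Real.smoothTransition.one_of_one_le (by linarith : 1 ≤ t - 1)]
  · intro t
    exact ⟨sub_nonneg.2 (Real.smoothTransition.le_one _),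
      sub_le_self _ (Real.smoothTransition.nonneg _)⟩
  · -- the derivative is continuous and vanishes off `[1, 2]`
    set φ : ℝ → ℝ := fun t ↦ 1 - Real.smoothTransition (t - 1) with hφ
    have hφs : ContDiff ℝ ∞ φ :=
      contDiff_const.sub (Real.smoothTransition.contDiff.comp (contDiff_id.sub contDiff_const))
    have hcont : Continuous (deriv φ) := hφs.continuous_deriv ENat.LEInfty.out
    have hsupp : HasCompactSupport (deriv φ) := by
      refine HasCompactSupport.intro (K := Icc (1 : ℝ) 2) isCompact_Icc fun t ht ↦ ?_
      rw [mem_Icc, not_and_or, not_le, not_le] at ht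
      rcases ht with ht | ht
      · have hev : φ =ᶠ[𝓝 t] fun _ ↦ (1 : ℝ) := by
          filter_upwards [Iio_mem_nhds ht] with s hs
          simp [hφ, Real.smoothTransition.zero_of_nonpos (by linarith [mem_Iio.1 hs] : s - 1 ≤ 0)]
        rw [hev.deriv_eq, deriv_const]
      · have hev : φ =ᶠ[𝓝 t] fun _ ↦ (0 : ℝ) := by
          filter_upwards [Ioi_mem_nhds ht] with s hs
          simp [hφ, Real.smoothTransition.one_of_one_le (by linarith [mem_Ioi.1 hs] : 1 ≤ s - 1)]
        rw [hev.deriv_eq, deriv_const]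
    obtain ⟨C, hC⟩ := hcont.bounded_above_of_compact_support hsupp
    exact ⟨C, fun t ↦ by simpa [Real.norm_eq_abs] using hC t⟩

/-- **`∫_M Δ_g w dV_g = 0` on a manifold exhausted by a proper smooth function** (the cut-off
argument behind the integrations by parts of Carrillo–Ni 2009, §4, on a complete noncompact
soliton, where the potential `f` itself is the exhaustion function by Lemma 2.1). Let `g` be
Riemannian, `ρ` smooth with compact sublevel sets `{ρ ≤ R}`, `w ∈ C²(M)` with `Δ_g w` and
`g⁻¹(dρ, dw)` integrable. Then `∫_M Δ_g w dV_g = 0`: with `χ_R = φ(ρ/R)` (`φ` a cut-off profile),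
Green's first identity for the compactly supported `χ_R` (`GreenIdentityCompactSupport.lean`) gives
`∫ χ_R Δw = −∫ g⁻¹(dχ_R, dw) = −R⁻¹ ∫ φ'(ρ/R) g⁻¹(dρ, dw) = O(R⁻¹)`, while `∫ χ_R Δw → ∫ Δw` by
dominated convergence. [cite: CarrilloNi2009, §4 (integration by parts on the complete soliton)] -/
theorem integral_dalembertian_eq_zero_of_proper (hg : g.IsRiemannian) {ρ w : M → ℝ}
    (hρ : ContMDiff (𝓡 n) 𝓘(ℝ, ℝ) ∞ ρ) (hprop : ∀ R : ℝ, IsCompact {x | ρ x ≤ R})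
    (hw : ContMDiff (𝓡 n) 𝓘(ℝ, ℝ) 2 w)
    (hΔ : Integrable (fun x ↦ g.dalembertian w x) g.riemVolume)
    (hcross : Integrable (fun x ↦ g.innerDual x (mvfderiv (𝓡 n) ρ x).toLinearMap
      (mvfderiv (𝓡 n) w x).toLinearMap) g.riemVolume) :
    ∫ x, g.dalembertian w x ∂g.riemVolume = 0 := by
  classical
  -- topology supplied by the exhaustion
  haveI : SigmaCompactSpace M := ⟨⟨fun k : ℕ ↦ {x | ρ x ≤ k}, fun k ↦ hprop k,
    eq_univ_of_forall fun x ↦ mem_iUnion.2 (exists_nat_ge (ρ x))⟩⟩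
  haveI : WeaklyLocallyCompactSpace M := ⟨fun x ↦ ⟨{y | ρ y ≤ ρ x + 1}, hprop _, by
    have hopen : IsOpen {y | ρ y < ρ x + 1} := isOpen_lt hρ.continuous continuous_const
    exact mem_of_superset (hopen.mem_nhds (show x ∈ {y | ρ y < ρ x + 1} from lt_add_one (ρ x)))
      fun y hy ↦ show ρ y ≤ ρ x + 1 from le_of_lt hy⟩⟩
  -- the cut-off profile and the cut-offs `χ k = φ (ρ / (k + 1))`
  obtain ⟨φ, hφs, hφ1, hφ0, hφ01, C, hC⟩ := exists_cutoffProfile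
  have hC0 : 0 ≤ C := (abs_nonneg _).trans (hC 0)
  set ζ : ℕ → ℝ → ℝ := fun k t ↦ φ (t / (k + 1)) with hζ
  have hζs : ∀ k, ContDiff ℝ ∞ (ζ k) := fun k ↦ hφs.comp (contDiff_id.div_const _)
  have hζd : ∀ k t, HasDerivAt (ζ k) (deriv φ (t / (k + 1)) / (k + 1)) t := fun k t ↦ by
    have h1 : HasDerivAt (fun s : ℝ ↦ s / (k + 1)) (1 / (k + 1)) t := (hasDerivAt_id t).div_const _
    have h2 : HasDerivAt φ (deriv φ (t / (k + 1))) (t / (k + 1)) :=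
      (hφs.differentiable (by norm_num) _).hasDerivAt
    simpa [hζ, div_eq_mul_inv, Function.comp_def] using h2.comp t h1
  set χ : ℕ → M → ℝ := fun k x ↦ ζ k (ρ x) with hχ
  have hχs : ∀ k, ContMDiff (𝓡 n) 𝓘(ℝ, ℝ) 1 (χ k) := fun k ↦
    ((hζs k).comp_contMDiff hρ).of_le ENat.LEInfty.out
  have hχc : ∀ k : ℕ, HasCompactSupport (χ k) := fun k ↦ by
    refine HasCompactSupport.intro (hprop (2 * (k + 1))) fun x hx ↦ ?_
    have hx' : 2 * ((k : ℝ) + 1) < ρ x := lt_of_not_ge hx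
    have hk : (0 : ℝ) < k + 1 := by positivity
    exact hφ0 _ (by rw [le_div_iff₀ hk]; linarith)
  have hχ_bound : ∀ k x, |χ k x| ≤ 1 := fun k x ↦ by
    rw [abs_le]
    exact ⟨by linarith [(hφ01 (ρ x / (k + 1))).1], (hφ01 _).2⟩
  have hχ_lim : ∀ x, Tendsto (fun k ↦ χ k x) atTop (𝓝 1) := fun x ↦ by
    refine tendsto_const_nhds.congr' ?_
    obtain ⟨N, hN⟩ := exists_nat_ge (ρ x)
    filter_upwards [eventually_ge_atTop N] with k hk
    refine (hφ1 _ ?_).symm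
    rw [div_le_one (by positivity)]
    calc ρ x ≤ N := hN
      _ ≤ k := by exact_mod_cast hk
      _ ≤ k + 1 := by linarith
  -- Green's first identity for the compactly supported `χ k`
  have hGreen : ∀ k, ∫ x, χ k x * g.dalembertian w x ∂g.riemVolume =
      -∫ x, g.innerDual x (mvfderiv (𝓡 n) (χ k) x).toLinearMap
        (mvfderiv (𝓡 n) w x).toLinearMap ∂g.riemVolume := fun k ↦ by
    haveI := (PseudoRiemannianMetric.ofRiemannian (g.toContMDiffRiemannianMetric hg)).hasLeviCivita
    have h1 := integral_mul_dalembertian_eq_neg_integral_innerDual_of_hasCompactSupport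
      (g.toContMDiffRiemannianMetric hg) (hχs k) (hχc k) hw
    rw [PseudoRiemannianMetric.riemVolume_eq hg]
    exact h1
  -- the chain rule `dχ_k = φ'(ρ/(k+1))/(k+1) dρ` inside `g⁻¹(dχ_k, dw)`
  have hchain : ∀ k x, g.innerDual x (mvfderiv (𝓡 n) (χ k) x).toLinearMap
      (mvfderiv (𝓡 n) w x).toLinearMap =
      deriv φ (ρ x / (k + 1)) / (k + 1) *
        g.innerDual x (mvfderiv (𝓡 n) ρ x).toLinearMap (mvfderiv (𝓡 n) w x).toLinearMap := by
    intro k x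
    have hd : (mvfderiv (𝓡 n) (χ k) x).toLinearMap =
        (deriv φ (ρ x / (k + 1)) / (k + 1)) • (mvfderiv (𝓡 n) ρ x).toLinearMap := by
      ext v
      have := mvfderiv_real_comp_apply (I := 𝓡 n) (hζd k (ρ x))
        (hρ.mdifferentiableAt (by norm_num)) v
      simpa [hχ, Function.comp_def] using this
    rw [hd]
    simp only [PseudoRiemannianMetric.innerDual, LinearMap.smul_apply, smul_eq_mul]
  -- the left-hand sides converge to `∫ Δw`
  have hL : Tendsto (fun k ↦ ∫ x, χ k x * g.dalembertian w x ∂g.riemVolume) atTop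
      (𝓝 (∫ x, g.dalembertian w x ∂g.riemVolume)) := by
    refine tendsto_integral_of_dominated_convergence (fun x ↦ |g.dalembertian w x|)
      (fun k ↦ ((hχs k).continuous.aestronglyMeasurable.mul hΔ.aestronglyMeasurable)) hΔ.abs
      (fun k ↦ Eventually.of_forall fun x ↦ ?_) (Eventually.of_forall fun x ↦ ?_)
    · rw [Real.norm_eq_abs, abs_mul]
      exact mul_le_of_le_one_left (abs_nonneg _) (hχ_bound k x)
    · simpa using (hχ_lim x).mul_const (g.dalembertian w x)
  -- the right-hand sides are `O(1/(k+1))`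
  have hR : Tendsto (fun k ↦ -∫ x, g.innerDual x (mvfderiv (𝓡 n) (χ k) x).toLinearMap
      (mvfderiv (𝓡 n) w x).toLinearMap ∂g.riemVolume) atTop (𝓝 0) := by
    set X : M → ℝ := fun x ↦ g.innerDual x (mvfderiv (𝓡 n) ρ x).toLinearMap
      (mvfderiv (𝓡 n) w x).toLinearMap with hX
    have hbd : ∀ k : ℕ, ‖-∫ x, g.innerDual x (mvfderiv (𝓡 n) (χ k) x).toLinearMap
        (mvfderiv (𝓡 n) w x).toLinearMap ∂g.riemVolume‖ ≤
        C / (k + 1) * ∫ x, |X x| ∂g.riemVolume := fun k ↦ by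
      rw [norm_neg]
      simp_rw [hchain k]
      calc ‖∫ x, deriv φ (ρ x / (k + 1)) / (k + 1) * X x ∂g.riemVolume‖
          ≤ ∫ x, ‖deriv φ (ρ x / (k + 1)) / (k + 1) * X x‖ ∂g.riemVolume :=
            norm_integral_le_integral_norm _
        _ ≤ ∫ x, C / (k + 1) * |X x| ∂g.riemVolume := by
            refine integral_mono_of_nonneg (Eventually.of_forall fun x ↦ norm_nonneg _)
              (hcross.abs.const_mul _) (Eventually.of_forall fun x ↦ ?_)
            show ‖deriv φ (ρ x / (k + 1)) / (k + 1) * X x‖ ≤ C / (k + 1) * |X x|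
            rw [Real.norm_eq_abs, abs_mul, abs_div]
            gcongr
            · exact hC _
            · rw [abs_of_pos (by positivity)]
        _ = C / (k + 1) * ∫ x, |X x| ∂g.riemVolume := integral_const_mul _ _
    refine squeeze_zero_norm hbd ?_
    have : Tendsto (fun k : ℕ ↦ C / ((k : ℝ) + 1)) atTop (𝓝 0) := by
      have h := tendsto_const_div_atTop_nhds_zero_nat C
      exact (h.comp (tendsto_add_atTop_nat 1)).congr fun k ↦ by simp
    simpa using this.mul_const (∫ x, |X x| ∂g.riemVolume)
  -- conclude
  have hL' : Tendsto (fun k ↦ ∫ x, χ k x * g.dalembertian w x ∂g.riemVolume) atTop (𝓝 0) := by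
    simpa only [hGreen] using hR
  exact tendsto_nhds_unique hL hL'

omit [T2Space M] [T3Space M] [MeasurableSpace M] [BorelSpace M] [g.HasLeviCivita] in
/-- `d(e^{-f}) = -e^{-f} df` inside the inverse metric: `g⁻¹(dρ, d(e^{-f})) = -e^{-f} g⁻¹(dρ, df)`.
[folklore] -/
theorem innerDual_mvfderiv_exp_neg {ρ f : M → ℝ} {x : M}
    (hfx : MDifferentiableAt (𝓡 n) 𝓘(ℝ, ℝ) f x) :
    g.innerDual x (mvfderiv (𝓡 n) ρ x).toLinearMap
        (mvfderiv (𝓡 n) (fun y ↦ Real.exp (-f y)) x).toLinearMap =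
      -Real.exp (-f x) *
        g.innerDual x (mvfderiv (𝓡 n) ρ x).toLinearMap (mvfderiv (𝓡 n) f x).toLinearMap := by
  have hd : HasDerivAt (fun s : ℝ ↦ Real.exp (-s)) (-Real.exp (-f x)) (f x) := by
    simpa using (hasDerivAt_neg (f x)).exp
  have hlin : (mvfderiv (𝓡 n) (fun y ↦ Real.exp (-f y)) x).toLinearMap =
      (-Real.exp (-f x)) • (mvfderiv (𝓡 n) f x).toLinearMap := by
    ext v
    have := mvfderiv_real_comp_apply (I := 𝓡 n) hd hfx v
    simpa [Function.comp_def] using this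
  rw [hlin]
  simp only [PseudoRiemannianMetric.innerDual, map_smul, smul_eq_mul]

/-- **Sharpness on a complete gradient shrinker, reduced to Lemma 2.1 / Cor. 2.1** (§4, "`u =
e^{-f}/(4πτ)^{n/2}` is the minimizer"; Cor. 4.1 `μ(g, 1) = −μ_s`, `−μ_s = log Θ` for the tree's
normalisation): for `g` Riemannian and `f` smooth with `Ric + Hess f = g/2`, `S + |∇f|² = f`, IF the
potential is proper (compact sublevel sets — Lemma 2.1, `f ≥ (r − C₁)²/4`) and `e^{-f}`, `f e^{-f}`,
`|∇f|² e^{-f}` are integrable (Cor. 2.1, (2.7)), THEN `𝒲(g, f + log Θ, 1) = log Θ`: the needed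
`∫ (2f − n) e^{-f} dV = 2 ∫ Δ(e^{-f}) dV = 0` is `integral_dalembertian_eq_zero_of_proper` with the
exhaustion `f` (`Δ(e^{-f}) = (f − n/2) e^{-f}`, `g⁻¹(df, d e^{-f}) = −|∇f|² e^{-f}`).
[cite: CarrilloNi2009, §4 with Lemma 2.1 and Cor. 2.1] -/
theorem wEntropy_add_log_eq_of_proper [Nonempty M] (hg : g.IsRiemannian)
    (hf : ContMDiff (𝓡 n) 𝓘(ℝ, ℝ) ∞ f)
    (hsol : ∀ (x : M) (X Y : TangentSpace (𝓡 n) x),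
      g.ricci x X Y + g.hessian f x X Y = (1 / 2 : ℝ) * g.val x X Y)
    (hnorm : ∀ x : M, g.scalarCurvature x + g.gradSq f x = f x)
    (hprop : ∀ R : ℝ, IsCompact {x | f x ≤ R})
    (hint : Integrable (fun x ↦ Real.exp (-f x)) g.riemVolume)
    (hfint : Integrable (fun x ↦ f x * Real.exp (-f x)) g.riemVolume)
    (hgint : Integrable (fun x ↦ g.gradSq f x * Real.exp (-f x)) g.riemVolume) :
    g.wEntropy g.leviCivita (fun y ↦ f y +
        Real.log ((4 * Real.pi) ^ (-(n : ℝ) / 2) * ∫ x, Real.exp (-f x) ∂g.riemVolume)) 1 =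
      Real.log ((4 * Real.pi) ^ (-(n : ℝ) / 2) * ∫ x, Real.exp (-f x) ∂g.riemVolume) := by
  refine wEntropy_add_log_eq hg hf hnorm hint hfint ?_
  have h2 : ContMDiff (𝓡 n) 𝓘(ℝ, ℝ) 2 (fun y ↦ Real.exp (-f y)) :=
    ((Real.contDiff_exp.comp contDiff_neg).comp_contMDiff hf).of_le ENat.LEInfty.out
  have hpt : ∀ x, g.dalembertian (fun y ↦ Real.exp (-f y)) x = (f x - n / 2) * Real.exp (-f x) :=
    dalembertian_exp_neg hsol hnorm hf
  have hΔ : Integrable (fun x ↦ g.dalembertian (fun y ↦ Real.exp (-f y)) x) g.riemVolume := by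
    refine ((hfint.sub (hint.const_mul ((n : ℝ) / 2))).congr (Eventually.of_forall fun x ↦ ?_))
    simp only [Pi.sub_apply, hpt]
    ring
  have hcross : Integrable (fun x ↦ g.innerDual x (mvfderiv (𝓡 n) f x).toLinearMap
      (mvfderiv (𝓡 n) (fun y ↦ Real.exp (-f y)) x).toLinearMap) g.riemVolume := by
    refine (hgint.neg.congr (Eventually.of_forall fun x ↦ ?_))
    show -(g.gradSq f x * Real.exp (-f x)) = g.innerDual x (mvfderiv (𝓡 n) f x).toLinearMap
      (mvfderiv (𝓡 n) (fun y ↦ Real.exp (-f y)) x).toLinearMap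
    rw [innerDual_mvfderiv_exp_neg (hf.mdifferentiableAt (by norm_num)),
      PseudoRiemannianMetric.gradSq]
    ring
  have h0 := integral_dalembertian_eq_zero_of_proper hg hf hprop h2 hΔ hcross
  simp_rw [hpt] at h0
  have h3 : ∀ x, (2 * f x - n) * Real.exp (-f x) = 2 * ((f x - n / 2) * Real.exp (-f x)) :=
    fun x ↦ by ring
  simp_rw [h3]
  rw [integral_const_mul, h0, mul_zero]

/-- **Thm. 1.1 (i) and sharpness on a complete gradient shrinker ⇒ `μ(g, 1) ≤ log Θ`, reduced to
Lemma 2.1 / Cor. 2.1**: under the provisos of `wEntropy_add_log_eq_of_proper` the compatible shift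
`f + log Θ` is admissible and `𝒲(g, f + log Θ, 1) = log Θ`, so `muEntropy_le` applies.
[cite: CarrilloNi2009, Thm. 1.1 (i), §4 and Cor. 4.1, with Lemma 2.1 and Cor. 2.1] -/
theorem muEntropy_le_log_of_proper [Nonempty M] (hg : g.IsRiemannian)
    (hf : ContMDiff (𝓡 n) 𝓘(ℝ, ℝ) ∞ f)
    (hsol : ∀ (x : M) (X Y : TangentSpace (𝓡 n) x),
      g.ricci x X Y + g.hessian f x X Y = (1 / 2 : ℝ) * g.val x X Y)
    (hnorm : ∀ x : M, g.scalarCurvature x + g.gradSq f x = f x)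
    (hprop : ∀ R : ℝ, IsCompact {x | f x ≤ R})
    (hint : Integrable (fun x ↦ Real.exp (-f x)) g.riemVolume)
    (hfint : Integrable (fun x ↦ f x * Real.exp (-f x)) g.riemVolume)
    (hgint : Integrable (fun x ↦ g.gradSq f x * Real.exp (-f x)) g.riemVolume) :
    g.muEntropy g.leviCivita 1 ≤
      ((Real.log ((4 * Real.pi) ^ (-(n : ℝ) / 2) * ∫ x, Real.exp (-f x) ∂g.riemVolume) : ℝ) :
        EReal) := by
  have hcompat := isEntropyCompatible_add_log hg hint
  have hsmooth : ContMDiff (𝓡 n) 𝓘(ℝ, ℝ) ∞ fun y ↦ f y +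
      Real.log ((4 * Real.pi) ^ (-(n : ℝ) / 2) * ∫ x, Real.exp (-f x) ∂g.riemVolume) :=
    hf.add contMDiff_const
  have hle := PseudoRiemannianMetric.muEntropy_le (cov := g.leviCivita) hsmooth hcompat
  rwa [wEntropy_add_log_eq_of_proper hg hf hsol hnorm hprop hint hfint hgint] at hle

end Exhaustion

section LSIReduction

variable {n : ℕ} {M : Type*} [TopologicalSpace M] [ChartedSpace (EuclideanSpace ℝ (Fin n)) M]
  [IsManifold (𝓡 n) ∞ M] [T3Space M] [MeasurableSpace M] [BorelSpace M]
  {g : PseudoRiemannianMetric (𝓡 n) ∞ (EuclideanSpace ℝ (Fin n)) (TangentSpace (𝓡 n) : M → Type _)}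
  {f : M → ℝ}

omit [T3Space M] [MeasurableSpace M] [BorelSpace M] in
/-- `|∇(f − ψ)|² = |∇f|² − 2 g⁻¹(df, dψ) + |∇ψ|²` (bilinearity and symmetry of `g⁻¹`). [folklore] -/
theorem gradSq_sub {ψ : M → ℝ} {x : M} (hfx : MDifferentiableAt (𝓡 n) 𝓘(ℝ, ℝ) f x)
    (hψx : MDifferentiableAt (𝓡 n) 𝓘(ℝ, ℝ) ψ x) :
    g.gradSq (fun y ↦ f y - ψ y) x =
      g.gradSq f x - 2 * g.innerDual x (mvfderiv (𝓡 n) f x).toLinearMap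
        (mvfderiv (𝓡 n) ψ x).toLinearMap + g.gradSq ψ x := by
  have hd : (mvfderiv (𝓡 n) (fun y ↦ f y - ψ y) x).toLinearMap =
      (mvfderiv (𝓡 n) f x).toLinearMap - (mvfderiv (𝓡 n) ψ x).toLinearMap := by
    rw [mvfderiv_fun_sub hfx hψx]
    simp
  have hsym := g.innerDual_comm x (mvfderiv (𝓡 n) ψ x).toLinearMap
    (mvfderiv (𝓡 n) f x).toLinearMap
  simp only [PseudoRiemannianMetric.innerDual] at hsym
  simp only [PseudoRiemannianMetric.gradSq, PseudoRiemannianMetric.innerDual, hd, map_sub,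
    LinearMap.sub_apply]
  rw [hsym]
  ring

variable [g.HasLeviCivita]

/-- **§4: from the LSI `H_V(ρ) ≤ τ I_V(ρ)` (Thm. 3.1 with `K = 1/(2τ)`, `τ = 1`) to Perelman's
`𝒲`-form `∫ [(|∇ψ|² + S) + ψ − n] ρ dΓ ≥ −μ_s`** — the computation
"`I_V(ρ) = ∫ (|∇ψ|²ρ + 2⟨∇f, ∇ρ⟩ + |∇f|²ρ) dΓ = ∫ [|∇ψ|² + S + (f + μ_s − n)] ρ dΓ`" of p. 9, for
the reference measure `e^{-V} dΓ`, `V = f + log Θ + (n/2) log (4π)` (so `−μ_s = log Θ`), and a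
smooth density `ρ = u = (4π)^{-n/2} e^{-ψ}` of unit mass, for which `H_V = ∫ (f + log Θ − ψ) u` and
`I_V = ∫ |∇(f − ψ)|² u`. Its two analytic inputs enter as hypotheses on this `ψ` — the LSI itself
(`hlsi`, Thm. 3.1) and the integration by parts `∫ g⁻¹(df, dψ) u = −∫ g⁻¹(df, du) = ∫ u Δf` on the
complete soliton (`hibp`) — together with the integrability of `f u`, `ψ u`, `S u`, `|∇ψ|² u`,
`g⁻¹(df, dψ) u` (Cor. 2.1 and the bounded second moment of `u`). Conclusion: `log Θ ≤ 𝒲(g, ψ, 1)`.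
[cite: CarrilloNi2009, §4, derivation of (4.1) from Thm. 3.1] -/
theorem log_le_wEntropy_of_lsi (hnorm : ∀ x : M, g.scalarCurvature x + g.gradSq f x = f x)
    (hsol : ∀ (x : M) (X Y : TangentSpace (𝓡 n) x),
      g.ricci x X Y + g.hessian f x X Y = (1 / 2 : ℝ) * g.val x X Y)
    (hf : ContMDiff (𝓡 n) 𝓘(ℝ, ℝ) ∞ f) {ψ : M → ℝ} (hψ : ContMDiff (𝓡 n) 𝓘(ℝ, ℝ) ∞ ψ)
    (hψc : g.IsEntropyCompatible ψ 1)
    (hfu : Integrable (fun x ↦ f x * entropyDensity n ψ 1 x) g.riemVolume)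
    (hψu : Integrable (fun x ↦ ψ x * entropyDensity n ψ 1 x) g.riemVolume)
    (hSu : Integrable (fun x ↦ g.scalarCurvature x * entropyDensity n ψ 1 x) g.riemVolume)
    (hgradu : Integrable (fun x ↦ g.gradSq ψ x * entropyDensity n ψ 1 x) g.riemVolume)
    (hcrossu : Integrable (fun x ↦ g.innerDual x (mvfderiv (𝓡 n) f x).toLinearMap
      (mvfderiv (𝓡 n) ψ x).toLinearMap * entropyDensity n ψ 1 x) g.riemVolume)
    (hibp : ∫ x, g.innerDual x (mvfderiv (𝓡 n) f x).toLinearMap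
        (mvfderiv (𝓡 n) ψ x).toLinearMap * entropyDensity n ψ 1 x ∂g.riemVolume =
      ∫ x, g.dalembertian f x * entropyDensity n ψ 1 x ∂g.riemVolume)
    {c : ℝ}
    (hlsi : ∫ x, (f x + c - ψ x) * entropyDensity n ψ 1 x ∂g.riemVolume ≤
      ∫ x, g.gradSq (fun y ↦ f y - ψ y) x * entropyDensity n ψ 1 x ∂g.riemVolume) :
    c ≤ g.wEntropy g.leviCivita ψ 1 := by
  -- unit mass and integrability of `u`
  have h1 : ∫ x, entropyDensity n ψ 1 x ∂g.riemVolume = 1 := by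
    have := hψc
    rw [PseudoRiemannianMetric.isEntropyCompatible_iff, finrank_euclideanSpace_fin] at this
    exact this
  have huI : Integrable (entropyDensity n ψ 1) g.riemVolume := by
    by_contra hni
    rw [integral_undef hni] at h1
    exact zero_ne_one h1
  -- the soliton identities
  have hgradf : ∀ x, g.gradSq f x = f x - g.scalarCurvature x := fun x ↦ by linarith [hnorm x]
  have hΔf : ∀ x, g.dalembertian f x = n / 2 - g.scalarCurvature x := fun x ↦ by
    linarith [scalarCurvature_add_dalembertian hsol x]
  -- `∫ g⁻¹(df, dψ) u = n/2 - ∫ S u`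
  have hcross_val : ∫ x, g.innerDual x (mvfderiv (𝓡 n) f x).toLinearMap
      (mvfderiv (𝓡 n) ψ x).toLinearMap * entropyDensity n ψ 1 x ∂g.riemVolume =
      n / 2 - ∫ x, g.scalarCurvature x * entropyDensity n ψ 1 x ∂g.riemVolume := by
    rw [hibp]
    have : ∀ x, g.dalembertian f x * entropyDensity n ψ 1 x =
        (n : ℝ) / 2 * entropyDensity n ψ 1 x - g.scalarCurvature x * entropyDensity n ψ 1 x :=
      fun x ↦ by rw [hΔf x]; ring
    simp_rw [this]
    rw [integral_sub (huI.const_mul _) hSu, integral_const_mul, h1, mul_one]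
  -- `∫ |∇(f - ψ)|² u = ∫ f u + ∫ S u + ∫ |∇ψ|² u - n`
  have hI : ∫ x, g.gradSq (fun y ↦ f y - ψ y) x * entropyDensity n ψ 1 x ∂g.riemVolume =
      ∫ x, f x * entropyDensity n ψ 1 x ∂g.riemVolume +
        ∫ x, g.scalarCurvature x * entropyDensity n ψ 1 x ∂g.riemVolume +
        ∫ x, g.gradSq ψ x * entropyDensity n ψ 1 x ∂g.riemVolume - n := by
    have hpt : ∀ x, g.gradSq (fun y ↦ f y - ψ y) x * entropyDensity n ψ 1 x =
        (f x * entropyDensity n ψ 1 x - g.scalarCurvature x * entropyDensity n ψ 1 x) -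
          2 * (g.innerDual x (mvfderiv (𝓡 n) f x).toLinearMap
            (mvfderiv (𝓡 n) ψ x).toLinearMap * entropyDensity n ψ 1 x) +
          g.gradSq ψ x * entropyDensity n ψ 1 x := fun x ↦ by
      rw [gradSq_sub (hf.mdifferentiableAt (by norm_num)) (hψ.mdifferentiableAt (by norm_num)),
        hgradf x]
      ring
    simp_rw [hpt]
    have iA : Integrable (fun x ↦ f x * entropyDensity n ψ 1 x -
        g.scalarCurvature x * entropyDensity n ψ 1 x) g.riemVolume := hfu.sub hSu
    have iB : Integrable (fun x ↦ 2 * (g.innerDual x (mvfderiv (𝓡 n) f x).toLinearMap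
        (mvfderiv (𝓡 n) ψ x).toLinearMap * entropyDensity n ψ 1 x)) g.riemVolume :=
      hcrossu.const_mul 2
    have iC : Integrable (fun x ↦ (f x * entropyDensity n ψ 1 x -
        g.scalarCurvature x * entropyDensity n ψ 1 x) -
        2 * (g.innerDual x (mvfderiv (𝓡 n) f x).toLinearMap
          (mvfderiv (𝓡 n) ψ x).toLinearMap * entropyDensity n ψ 1 x)) g.riemVolume := iA.sub iB
    rw [integral_add iC hgradu, integral_sub iA iB, integral_sub hfu hSu, integral_const_mul,
      hcross_val]
    ring
  -- `H = ∫ f u + c - ∫ ψ u`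
  have hH : ∫ x, (f x + c - ψ x) * entropyDensity n ψ 1 x ∂g.riemVolume =
      ∫ x, f x * entropyDensity n ψ 1 x ∂g.riemVolume + c -
        ∫ x, ψ x * entropyDensity n ψ 1 x ∂g.riemVolume := by
    have hpt : ∀ x, (f x + c - ψ x) * entropyDensity n ψ 1 x =
        f x * entropyDensity n ψ 1 x + c * entropyDensity n ψ 1 x -
          ψ x * entropyDensity n ψ 1 x := fun x ↦ by ring
    simp_rw [hpt]
    have iu : Integrable (fun x ↦ c * entropyDensity n ψ 1 x) g.riemVolume := huI.const_mul c
    have iA : Integrable (fun x ↦ f x * entropyDensity n ψ 1 x + c * entropyDensity n ψ 1 x)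
        g.riemVolume := hfu.add iu
    rw [integral_sub iA hψu, integral_add hfu iu, integral_const_mul, h1, mul_one]
  -- `𝒲(g, ψ, 1) = ∫ S u + ∫ |∇ψ|² u + ∫ ψ u - n`
  have hW : g.wEntropy g.leviCivita ψ 1 =
      ∫ x, g.scalarCurvature x * entropyDensity n ψ 1 x ∂g.riemVolume +
        ∫ x, g.gradSq ψ x * entropyDensity n ψ 1 x ∂g.riemVolume +
        ∫ x, ψ x * entropyDensity n ψ 1 x ∂g.riemVolume - n := by
    rw [PseudoRiemannianMetric.wEntropy_def, finrank_euclideanSpace_fin]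
    have hpt : ∀ x, (1 * (g.scalarCurvatureWith g.leviCivita x + g.gradSq ψ x) + ψ x - (n : ℕ)) *
        entropyDensity n ψ 1 x =
        g.scalarCurvature x * entropyDensity n ψ 1 x + g.gradSq ψ x * entropyDensity n ψ 1 x +
          ψ x * entropyDensity n ψ 1 x - (n : ℝ) * entropyDensity n ψ 1 x := fun x ↦ by
      rw [PseudoRiemannianMetric.scalarCurvatureWith_leviCivita]
      ring
    simp_rw [hpt]
    have iu : Integrable (fun x ↦ (n : ℝ) * entropyDensity n ψ 1 x) g.riemVolume :=
      huI.const_mul _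
    have iA : Integrable (fun x ↦ g.scalarCurvature x * entropyDensity n ψ 1 x +
        g.gradSq ψ x * entropyDensity n ψ 1 x) g.riemVolume := hSu.add hgradu
    have iB : Integrable (fun x ↦ g.scalarCurvature x * entropyDensity n ψ 1 x +
        g.gradSq ψ x * entropyDensity n ψ 1 x + ψ x * entropyDensity n ψ 1 x) g.riemVolume :=
      iA.add hψu
    rw [integral_sub iB iu, integral_add iA hψu, integral_add hSu hgradu, integral_const_mul, h1,
      mul_one]
  rw [hI, hH] at hlsi
  rw [hW]
  linarith

end LSIReduction

section GreenProper

variable {n : ℕ} {M : Type*} [TopologicalSpace M] [ChartedSpace (EuclideanSpace ℝ (Fin n)) M]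
  [IsManifold (𝓡 n) ∞ M] [T3Space M] [MeasurableSpace M] [BorelSpace M]
  {g : PseudoRiemannianMetric (𝓡 n) ∞ (EuclideanSpace ℝ (Fin n)) (TangentSpace (𝓡 n) : M → Type _)}
  [g.HasLeviCivita] {f : M → ℝ}

/-- **Green's first identity on a manifold exhausted by a proper smooth function** (the general
form of the cut-off argument of Carrillo–Ni 2009, §4: "`∫ 2⟨∇f, ∇ρ⟩ dΓ = ∫ (−2Δf) ρ dΓ`" on the
complete soliton): for `g` Riemannian, `ρ` smooth with compact sublevel sets, `u ∈ C¹(M)`,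
`w ∈ C²(M)` with `u Δ_g w`, `g⁻¹(du, dw)` and `u g⁻¹(dρ, dw)` integrable,
`∫_M u Δ_g w dV_g = −∫_M g⁻¹(du, dw) dV_g`. Proof: Green's first identity for the compactly
supported `χ_R u`, `χ_R = φ(ρ/R)` (`GreenIdentityCompactSupport.lean`), the Leibniz rule
`d(χ_R u) = χ_R du + u dχ_R`, `dχ_R = R⁻¹ φ'(ρ/R) dρ`, and dominated convergence as `R → ∞`.
[cite: CarrilloNi2009, §4 (integration by parts on the complete soliton)] -/
theorem integral_mul_dalembertian_eq_neg_integral_innerDual_of_proper (hg : g.IsRiemannian)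
    {ρ u w : M → ℝ} (hρ : ContMDiff (𝓡 n) 𝓘(ℝ, ℝ) ∞ ρ) (hprop : ∀ R : ℝ, IsCompact {x | ρ x ≤ R})
    (hu : ContMDiff (𝓡 n) 𝓘(ℝ, ℝ) 1 u) (hw : ContMDiff (𝓡 n) 𝓘(ℝ, ℝ) 2 w)
    (huΔ : Integrable (fun x ↦ u x * g.dalembertian w x) g.riemVolume)
    (hduw : Integrable (fun x ↦ g.innerDual x (mvfderiv (𝓡 n) u x).toLinearMap
      (mvfderiv (𝓡 n) w x).toLinearMap) g.riemVolume)
    (hcross : Integrable (fun x ↦ u x * g.innerDual x (mvfderiv (𝓡 n) ρ x).toLinearMap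
      (mvfderiv (𝓡 n) w x).toLinearMap) g.riemVolume) :
    ∫ x, u x * g.dalembertian w x ∂g.riemVolume =
      -∫ x, g.innerDual x (mvfderiv (𝓡 n) u x).toLinearMap (mvfderiv (𝓡 n) w x).toLinearMap
        ∂g.riemVolume := by
  classical
  -- topology supplied by the exhaustion
  haveI : SigmaCompactSpace M := ⟨⟨fun k : ℕ ↦ {x | ρ x ≤ k}, fun k ↦ hprop k,
    eq_univ_of_forall fun x ↦ mem_iUnion.2 (exists_nat_ge (ρ x))⟩⟩
  haveI : WeaklyLocallyCompactSpace M := ⟨fun x ↦ ⟨{y | ρ y ≤ ρ x + 1}, hprop _, by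
    have hopen : IsOpen {y | ρ y < ρ x + 1} := isOpen_lt hρ.continuous continuous_const
    exact mem_of_superset (hopen.mem_nhds (show x ∈ {y | ρ y < ρ x + 1} from lt_add_one (ρ x)))
      fun y hy ↦ show ρ y ≤ ρ x + 1 from le_of_lt hy⟩⟩
  -- the cut-off profile and the cut-offs `χ k = φ (ρ / (k + 1))`
  obtain ⟨φ, hφs, hφ1, hφ0, hφ01, C, hC⟩ := exists_cutoffProfile
  have hC0 : 0 ≤ C := (abs_nonneg _).trans (hC 0)
  set ζ : ℕ → ℝ → ℝ := fun k t ↦ φ (t / (k + 1)) with hζ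
  have hζs : ∀ k, ContDiff ℝ ∞ (ζ k) := fun k ↦ hφs.comp (contDiff_id.div_const _)
  have hζd : ∀ k t, HasDerivAt (ζ k) (deriv φ (t / (k + 1)) / (k + 1)) t := fun k t ↦ by
    have h1 : HasDerivAt (fun s : ℝ ↦ s / (k + 1)) (1 / (k + 1)) t := (hasDerivAt_id t).div_const _
    have h2 : HasDerivAt φ (deriv φ (t / (k + 1))) (t / (k + 1)) :=
      (hφs.differentiable (by norm_num) _).hasDerivAt
    simpa [hζ, div_eq_mul_inv, Function.comp_def] using h2.comp t h1
  set χ : ℕ → M → ℝ := fun k x ↦ ζ k (ρ x) with hχ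
  have hχs : ∀ k, ContMDiff (𝓡 n) 𝓘(ℝ, ℝ) 1 (χ k) := fun k ↦
    ((hζs k).comp_contMDiff hρ).of_le ENat.LEInfty.out
  have hχc : ∀ k : ℕ, HasCompactSupport (χ k) := fun k ↦ by
    refine HasCompactSupport.intro (hprop (2 * (k + 1))) fun x hx ↦ ?_
    have hx' : 2 * ((k : ℝ) + 1) < ρ x := lt_of_not_ge hx
    have hk : (0 : ℝ) < k + 1 := by positivity
    exact hφ0 _ (by rw [le_div_iff₀ hk]; linarith)
  have hχ_bound : ∀ k x, |χ k x| ≤ 1 := fun k x ↦ by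
    rw [abs_le]
    exact ⟨by linarith [(hφ01 (ρ x / (k + 1))).1], (hφ01 _).2⟩
  have hχ_lim : ∀ x, Tendsto (fun k ↦ χ k x) atTop (𝓝 1) := fun x ↦ by
    refine tendsto_const_nhds.congr' ?_
    obtain ⟨N, hN⟩ := exists_nat_ge (ρ x)
    filter_upwards [eventually_ge_atTop N] with k hk
    refine (hφ1 _ ?_).symm
    rw [div_le_one (by positivity)]
    calc ρ x ≤ N := hN
      _ ≤ k := by exact_mod_cast hk
      _ ≤ k + 1 := by linarith
  -- Green's first identity for the compactly supported `χ k * u`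
  have hχu : ∀ k, ContMDiff (𝓡 n) 𝓘(ℝ, ℝ) 1 (fun x ↦ χ k x * u x) := fun k ↦ (hχs k).mul hu
  have hχuc : ∀ k, HasCompactSupport (fun x ↦ χ k x * u x) := fun k ↦ (hχc k).mul_right
  have hGreen : ∀ k, ∫ x, (χ k x * u x) * g.dalembertian w x ∂g.riemVolume =
      -∫ x, g.innerDual x (mvfderiv (𝓡 n) (fun y ↦ χ k y * u y) x).toLinearMap
        (mvfderiv (𝓡 n) w x).toLinearMap ∂g.riemVolume := fun k ↦ by
    haveI := (PseudoRiemannianMetric.ofRiemannian (g.toContMDiffRiemannianMetric hg)).hasLeviCivita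
    have h1 := integral_mul_dalembertian_eq_neg_integral_innerDual_of_hasCompactSupport
      (g.toContMDiffRiemannianMetric hg) (hχu k) (hχuc k) hw
    rw [PseudoRiemannianMetric.riemVolume_eq hg]
    exact h1
  -- the Leibniz and chain rules inside `g⁻¹(d(χ_k u), dw)`
  have hleib : ∀ k x, g.innerDual x (mvfderiv (𝓡 n) (fun y ↦ χ k y * u y) x).toLinearMap
      (mvfderiv (𝓡 n) w x).toLinearMap =
      χ k x * g.innerDual x (mvfderiv (𝓡 n) u x).toLinearMap (mvfderiv (𝓡 n) w x).toLinearMap +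
        deriv φ (ρ x / (k + 1)) / (k + 1) *
          (u x * g.innerDual x (mvfderiv (𝓡 n) ρ x).toLinearMap
            (mvfderiv (𝓡 n) w x).toLinearMap) := by
    intro k x
    have hρx : MDifferentiableAt (𝓡 n) 𝓘(ℝ, ℝ) ρ x := hρ.mdifferentiableAt (by norm_num)
    have hχx : MDifferentiableAt (𝓡 n) 𝓘(ℝ, ℝ) (χ k) x := (hχs k).mdifferentiableAt one_ne_zero
    have hux : MDifferentiableAt (𝓡 n) 𝓘(ℝ, ℝ) u x := hu.mdifferentiableAt one_ne_zero
    have hdχ : (mvfderiv (𝓡 n) (χ k) x).toLinearMap =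
        (deriv φ (ρ x / (k + 1)) / (k + 1)) • (mvfderiv (𝓡 n) ρ x).toLinearMap := by
      ext v
      have := mvfderiv_real_comp_apply (I := 𝓡 n) (hζd k (ρ x)) hρx v
      simpa [hχ, Function.comp_def] using this
    have hprod : (mvfderiv (𝓡 n) (fun y ↦ χ k y * u y) x).toLinearMap =
        χ k x • (mvfderiv (𝓡 n) u x).toLinearMap + u x • (mvfderiv (𝓡 n) (χ k) x).toLinearMap := by
      rw [mvfderiv_fun_mul hχx hux]
      simp
    rw [hprod, hdχ]
    simp only [PseudoRiemannianMetric.innerDual, LinearMap.add_apply, LinearMap.smul_apply,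
      smul_eq_mul]
    ring
  -- the three limits
  have hL : Tendsto (fun k ↦ ∫ x, (χ k x * u x) * g.dalembertian w x ∂g.riemVolume) atTop
      (𝓝 (∫ x, u x * g.dalembertian w x ∂g.riemVolume)) := by
    refine tendsto_integral_of_dominated_convergence (fun x ↦ |u x * g.dalembertian w x|)
      (fun k ↦ ?_) huΔ.abs (fun k ↦ Eventually.of_forall fun x ↦ ?_)
      (Eventually.of_forall fun x ↦ ?_)
    · exact ((hχs k).continuous.aestronglyMeasurable.mul huΔ.aestronglyMeasurable).congr
        (Eventually.of_forall fun x ↦ by simp [mul_assoc])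
    · rw [Real.norm_eq_abs, mul_assoc, abs_mul]
      exact mul_le_of_le_one_left (abs_nonneg _) (hχ_bound k x)
    · simpa [mul_assoc] using (hχ_lim x).mul_const (u x * g.dalembertian w x)
  have hM : Tendsto (fun k ↦ ∫ x, χ k x * g.innerDual x (mvfderiv (𝓡 n) u x).toLinearMap
      (mvfderiv (𝓡 n) w x).toLinearMap ∂g.riemVolume) atTop
      (𝓝 (∫ x, g.innerDual x (mvfderiv (𝓡 n) u x).toLinearMap
        (mvfderiv (𝓡 n) w x).toLinearMap ∂g.riemVolume)) := by
    refine tendsto_integral_of_dominated_convergence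
      (fun x ↦ |g.innerDual x (mvfderiv (𝓡 n) u x).toLinearMap (mvfderiv (𝓡 n) w x).toLinearMap|)
      (fun k ↦ (hχs k).continuous.aestronglyMeasurable.mul hduw.aestronglyMeasurable) hduw.abs
      (fun k ↦ Eventually.of_forall fun x ↦ ?_) (Eventually.of_forall fun x ↦ ?_)
    · rw [Real.norm_eq_abs, abs_mul]
      exact mul_le_of_le_one_left (abs_nonneg _) (hχ_bound k x)
    · simpa using (hχ_lim x).mul_const
        (g.innerDual x (mvfderiv (𝓡 n) u x).toLinearMap (mvfderiv (𝓡 n) w x).toLinearMap)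
  have hR : Tendsto (fun k : ℕ ↦ ∫ x, deriv φ (ρ x / (k + 1)) / (k + 1) *
      (u x * g.innerDual x (mvfderiv (𝓡 n) ρ x).toLinearMap
        (mvfderiv (𝓡 n) w x).toLinearMap) ∂g.riemVolume) atTop (𝓝 0) := by
    set X : M → ℝ := fun x ↦ u x * g.innerDual x (mvfderiv (𝓡 n) ρ x).toLinearMap
      (mvfderiv (𝓡 n) w x).toLinearMap with hX
    have hbd : ∀ k : ℕ, ‖∫ x, deriv φ (ρ x / (k + 1)) / (k + 1) * X x ∂g.riemVolume‖ ≤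
        C / (k + 1) * ∫ x, |X x| ∂g.riemVolume := fun k ↦ by
      calc ‖∫ x, deriv φ (ρ x / (k + 1)) / (k + 1) * X x ∂g.riemVolume‖
          ≤ ∫ x, ‖deriv φ (ρ x / (k + 1)) / (k + 1) * X x‖ ∂g.riemVolume :=
            norm_integral_le_integral_norm _
        _ ≤ ∫ x, C / (k + 1) * |X x| ∂g.riemVolume := by
            refine integral_mono_of_nonneg (Eventually.of_forall fun x ↦ norm_nonneg _)
              (hcross.abs.const_mul _) (Eventually.of_forall fun x ↦ ?_)
            show ‖deriv φ (ρ x / (k + 1)) / (k + 1) * X x‖ ≤ C / (k + 1) * |X x|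
            rw [Real.norm_eq_abs, abs_mul, abs_div]
            gcongr
            · exact hC _
            · rw [abs_of_pos (by positivity)]
        _ = C / (k + 1) * ∫ x, |X x| ∂g.riemVolume := integral_const_mul _ _
    refine squeeze_zero_norm hbd ?_
    have : Tendsto (fun k : ℕ ↦ C / ((k : ℝ) + 1)) atTop (𝓝 0) := by
      have h := tendsto_const_div_atTop_nhds_zero_nat C
      exact (h.comp (tendsto_add_atTop_nat 1)).congr fun k ↦ by simp
    simpa using this.mul_const (∫ x, |X x| ∂g.riemVolume)
  -- assemble: `∫ χ_k u Δw = -(∫ χ_k g⁻¹(du,dw)) - ∫ (φ'/(k+1)) u g⁻¹(dρ,dw)`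
  have hsplit : ∀ k, ∫ x, (χ k x * u x) * g.dalembertian w x ∂g.riemVolume =
      -(∫ x, χ k x * g.innerDual x (mvfderiv (𝓡 n) u x).toLinearMap
          (mvfderiv (𝓡 n) w x).toLinearMap ∂g.riemVolume) -
        ∫ x, deriv φ (ρ x / (k + 1)) / (k + 1) *
          (u x * g.innerDual x (mvfderiv (𝓡 n) ρ x).toLinearMap
            (mvfderiv (𝓡 n) w x).toLinearMap) ∂g.riemVolume := fun k ↦ by
    rw [hGreen k]
    simp_rw [hleib k]
    have i1 : Integrable (fun x ↦ χ k x * g.innerDual x (mvfderiv (𝓡 n) u x).toLinearMap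
        (mvfderiv (𝓡 n) w x).toLinearMap) g.riemVolume :=
      hduw.bdd_mul (hχs k).continuous.aestronglyMeasurable
        (Eventually.of_forall fun x ↦ by simpa [Real.norm_eq_abs] using hχ_bound k x)
    have i2 : Integrable (fun x ↦ deriv φ (ρ x / (k + 1)) / (k + 1) *
        (u x * g.innerDual x (mvfderiv (𝓡 n) ρ x).toLinearMap
          (mvfderiv (𝓡 n) w x).toLinearMap)) g.riemVolume := by
      refine hcross.bdd_mul (c := C / (k + 1)) ?_ (Eventually.of_forall fun x ↦ ?_)
      · exact (((hφs.continuous_deriv ENat.LEInfty.out).comp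
          (hρ.continuous.div_const ((k : ℝ) + 1))).div_const ((k : ℝ) + 1)).aestronglyMeasurable
      · rw [Real.norm_eq_abs, abs_div, abs_of_pos (by positivity : (0 : ℝ) < k + 1)]
        gcongr
        exact hC _
    rw [integral_add i1 i2]
    ring
  have hlim : Tendsto (fun k ↦ ∫ x, (χ k x * u x) * g.dalembertian w x ∂g.riemVolume) atTop
      (𝓝 (-(∫ x, g.innerDual x (mvfderiv (𝓡 n) u x).toLinearMap
        (mvfderiv (𝓡 n) w x).toLinearMap ∂g.riemVolume) - 0)) := by
    simp_rw [hsplit]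
    exact hM.neg.sub hR
  rw [sub_zero] at hlim
  exact tendsto_nhds_unique hL hlim

/-- **The integration by parts of §4 for a smooth density**: on a gradient shrinker
(`Ric + Hess f = g/2`, `S + |∇f|² = f`) whose potential `f` is proper, for a smooth `ψ` with
density `u = (4π)^{-n/2} e^{-ψ}` such that `u`, `S u`, `f u` and `g⁻¹(df, dψ) u` are integrable,
`∫ g⁻¹(df, dψ) u dV = ∫ u Δf dV` ("`∫ 2⟨∇f, ∇ρ⟩ = ∫ (−2Δf) ρ`", p. 9, with `dρ = −ρ dψ`): Green's
identity with the exhaustion `f` (`Δf = n/2 − S`, `g⁻¹(du, df) = −u g⁻¹(df, dψ)`,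
`u g⁻¹(df, df) = u |∇f|² = u (f − S)`). [cite: CarrilloNi2009, §4 (integration by parts on the complete soliton)] -/
theorem integral_innerDual_mul_density_eq (hg : g.IsRiemannian) (hf : ContMDiff (𝓡 n) 𝓘(ℝ, ℝ) ∞ f)
    (hsol : ∀ (x : M) (X Y : TangentSpace (𝓡 n) x),
      g.ricci x X Y + g.hessian f x X Y = (1 / 2 : ℝ) * g.val x X Y)
    (hnorm : ∀ x : M, g.scalarCurvature x + g.gradSq f x = f x)
    (hprop : ∀ R : ℝ, IsCompact {x | f x ≤ R}) {ψ : M → ℝ} (hψ : ContMDiff (𝓡 n) 𝓘(ℝ, ℝ) ∞ ψ)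
    (huI : Integrable (entropyDensity n ψ 1) g.riemVolume)
    (hSu : Integrable (fun x ↦ g.scalarCurvature x * entropyDensity n ψ 1 x) g.riemVolume)
    (hfu : Integrable (fun x ↦ f x * entropyDensity n ψ 1 x) g.riemVolume)
    (hcrossu : Integrable (fun x ↦ g.innerDual x (mvfderiv (𝓡 n) f x).toLinearMap
      (mvfderiv (𝓡 n) ψ x).toLinearMap * entropyDensity n ψ 1 x) g.riemVolume) :
    ∫ x, g.innerDual x (mvfderiv (𝓡 n) f x).toLinearMap (mvfderiv (𝓡 n) ψ x).toLinearMap *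
        entropyDensity n ψ 1 x ∂g.riemVolume =
      ∫ x, g.dalembertian f x * entropyDensity n ψ 1 x ∂g.riemVolume := by
  -- `u` is `C¹` with `du = -u dψ`
  set u : M → ℝ := entropyDensity n ψ 1 with hu
  have hu_eq : u = fun x ↦ (4 * Real.pi * 1) ^ (-(n : ℝ) / 2) * Real.exp (-ψ x) := by
    funext x; rfl
  have hu1 : ContMDiff (𝓡 n) 𝓘(ℝ, ℝ) 1 u := by
    rw [hu_eq]
    exact (contMDiff_const.mul
      ((Real.contDiff_exp.comp contDiff_neg).comp_contMDiff hψ)).of_le ENat.LEInfty.out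
  have hdu : ∀ x, (mvfderiv (𝓡 n) u x).toLinearMap = (-u x) • (mvfderiv (𝓡 n) ψ x).toLinearMap := by
    intro x
    have hψx : MDifferentiableAt (𝓡 n) 𝓘(ℝ, ℝ) ψ x := hψ.mdifferentiableAt (by norm_num)
    have hd : HasDerivAt (fun s : ℝ ↦ (4 * Real.pi * 1) ^ (-(n : ℝ) / 2) * Real.exp (-s))
        ((4 * Real.pi * 1) ^ (-(n : ℝ) / 2) * -Real.exp (-ψ x)) (ψ x) := by
      simpa using ((hasDerivAt_neg (ψ x)).exp).const_mul ((4 * Real.pi * 1) ^ (-(n : ℝ) / 2))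
    ext v
    have := mvfderiv_real_comp_apply (I := 𝓡 n) hd hψx v
    rw [hu_eq]
    simp only [Function.comp_def] at this
    simp only [ContinuousLinearMap.coe_coe, LinearMap.smul_apply, smul_eq_mul]
    rw [this]
    ring
  -- the three integrability provisos of the general Green identity, with `ρ = w = f`
  have hΔf : ∀ x, g.dalembertian f x = n / 2 - g.scalarCurvature x := fun x ↦ by
    linarith [scalarCurvature_add_dalembertian hsol x]
  have huΔ : Integrable (fun x ↦ u x * g.dalembertian f x) g.riemVolume := by
    refine ((huI.const_mul ((n : ℝ) / 2)).sub hSu).congr (Eventually.of_forall fun x ↦ ?_)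
    simp only [Pi.sub_apply, hΔf x, hu]
    ring
  have hduw : Integrable (fun x ↦ g.innerDual x (mvfderiv (𝓡 n) u x).toLinearMap
      (mvfderiv (𝓡 n) f x).toLinearMap) g.riemVolume := by
    refine hcrossu.neg.congr (Eventually.of_forall fun x ↦ ?_)
    have hsym := g.innerDual_comm x (mvfderiv (𝓡 n) ψ x).toLinearMap
      (mvfderiv (𝓡 n) f x).toLinearMap
    show -(g.innerDual x (mvfderiv (𝓡 n) f x).toLinearMap (mvfderiv (𝓡 n) ψ x).toLinearMap *
      entropyDensity n ψ 1 x) = g.innerDual x (mvfderiv (𝓡 n) u x).toLinearMap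
        (mvfderiv (𝓡 n) f x).toLinearMap
    rw [hdu x]
    simp only [PseudoRiemannianMetric.innerDual, LinearMap.smul_apply, smul_eq_mul] at hsym ⊢
    rw [hsym, hu]
    ring
  have hcross : Integrable (fun x ↦ u x * g.innerDual x (mvfderiv (𝓡 n) f x).toLinearMap
      (mvfderiv (𝓡 n) f x).toLinearMap) g.riemVolume := by
    refine (hfu.sub hSu).congr (Eventually.of_forall fun x ↦ ?_)
    have hgradf : g.gradSq f x = f x - g.scalarCurvature x := by linarith [hnorm x]
    show f x * entropyDensity n ψ 1 x - g.scalarCurvature x * entropyDensity n ψ 1 x =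
      u x * g.innerDual x (mvfderiv (𝓡 n) f x).toLinearMap (mvfderiv (𝓡 n) f x).toLinearMap
    rw [show g.innerDual x (mvfderiv (𝓡 n) f x).toLinearMap (mvfderiv (𝓡 n) f x).toLinearMap =
      g.gradSq f x from rfl, hgradf, hu]
    ring
  have hG := integral_mul_dalembertian_eq_neg_integral_innerDual_of_proper hg hf hprop hu1
    (hf.of_le ENat.LEInfty.out) huΔ hduw hcross
  -- rewrite both sides
  have hlhs : ∀ x, g.innerDual x (mvfderiv (𝓡 n) u x).toLinearMap (mvfderiv (𝓡 n) f x).toLinearMap =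
      -(g.innerDual x (mvfderiv (𝓡 n) f x).toLinearMap (mvfderiv (𝓡 n) ψ x).toLinearMap *
        entropyDensity n ψ 1 x) := fun x ↦ by
    have hsym := g.innerDual_comm x (mvfderiv (𝓡 n) ψ x).toLinearMap
      (mvfderiv (𝓡 n) f x).toLinearMap
    rw [hdu x]
    simp only [PseudoRiemannianMetric.innerDual, LinearMap.smul_apply, smul_eq_mul] at hsym ⊢
    rw [hsym, hu]
    ring
  simp_rw [hlhs, integral_neg, neg_neg] at hG
  rw [← hG]
  refine integral_congr_ae (Eventually.of_forall fun x ↦ ?_)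
  simp only [hu]
  ring

end GreenProper

section LSIReductionProper

variable {n : ℕ} {M : Type*} [TopologicalSpace M] [ChartedSpace (EuclideanSpace ℝ (Fin n)) M]
  [IsManifold (𝓡 n) ∞ M] [T3Space M] [MeasurableSpace M] [BorelSpace M]
  {g : PseudoRiemannianMetric (𝓡 n) ∞ (EuclideanSpace ℝ (Fin n)) (TangentSpace (𝓡 n) : M → Type _)}
  [g.HasLeviCivita] {f : M → ℝ}

/-- **Clause (ii) reduced to Thm. 3.1 alone (plus Lemma 2.1 / Cor. 2.1 integrability)**: on a
gradient shrinker with proper potential, for a smooth unit-mass density `u = (4π)^{-n/2} e^{-ψ}`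
with `f u`, `ψ u`, `S u`, `|∇ψ|² u`, `g⁻¹(df, dψ) u` integrable, the LSI of Thm. 3.1 for this
density, `∫ (f + c − ψ) u ≤ ∫ |∇(f − ψ)|² u`, gives Perelman's form `c ≤ 𝒲(g, ψ, 1)` — the
integration by parts of `log_le_wEntropy_of_lsi` being `integral_innerDual_mul_density_eq`.
[cite: CarrilloNi2009, §4, derivation of (4.1) from Thm. 3.1] -/
theorem log_le_wEntropy_of_lsi_of_proper (hg : g.IsRiemannian)
    (hf : ContMDiff (𝓡 n) 𝓘(ℝ, ℝ) ∞ f)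
    (hsol : ∀ (x : M) (X Y : TangentSpace (𝓡 n) x),
      g.ricci x X Y + g.hessian f x X Y = (1 / 2 : ℝ) * g.val x X Y)
    (hnorm : ∀ x : M, g.scalarCurvature x + g.gradSq f x = f x)
    (hprop : ∀ R : ℝ, IsCompact {x | f x ≤ R}) {ψ : M → ℝ} (hψ : ContMDiff (𝓡 n) 𝓘(ℝ, ℝ) ∞ ψ)
    (hψc : g.IsEntropyCompatible ψ 1)
    (hfu : Integrable (fun x ↦ f x * entropyDensity n ψ 1 x) g.riemVolume)
    (hψu : Integrable (fun x ↦ ψ x * entropyDensity n ψ 1 x) g.riemVolume)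
    (hSu : Integrable (fun x ↦ g.scalarCurvature x * entropyDensity n ψ 1 x) g.riemVolume)
    (hgradu : Integrable (fun x ↦ g.gradSq ψ x * entropyDensity n ψ 1 x) g.riemVolume)
    (hcrossu : Integrable (fun x ↦ g.innerDual x (mvfderiv (𝓡 n) f x).toLinearMap
      (mvfderiv (𝓡 n) ψ x).toLinearMap * entropyDensity n ψ 1 x) g.riemVolume)
    {c : ℝ}
    (hlsi : ∫ x, (f x + c - ψ x) * entropyDensity n ψ 1 x ∂g.riemVolume ≤
      ∫ x, g.gradSq (fun y ↦ f y - ψ y) x * entropyDensity n ψ 1 x ∂g.riemVolume) :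
    c ≤ g.wEntropy g.leviCivita ψ 1 := by
  have h1 : ∫ x, entropyDensity n ψ 1 x ∂g.riemVolume = 1 := by
    have := hψc
    rw [PseudoRiemannianMetric.isEntropyCompatible_iff, finrank_euclideanSpace_fin] at this
    exact this
  have huI : Integrable (entropyDensity n ψ 1) g.riemVolume := by
    by_contra hni
    rw [integral_undef hni] at h1
    exact zero_ne_one h1
  exact log_le_wEntropy_of_lsi hnorm hsol hf hψ hψc hfu hψu hSu hgradu hcrossu
    (integral_innerDual_mul_density_eq hg hf hsol hnorm hprop hψ huI hSu hfu hcrossu) hlsi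

end LSIReductionProper

section Fatou

variable {α : Type*} [MeasurableSpace α]

/-- **Integrability from uniformly bounded cut-off integrals** (Fatou): if `F ≥ 0` is a.e.
strongly measurable, `0 ≤ χ_k`, `χ_k F` is integrable with `∫ χ_k F ≤ K` for all `k`, and
`χ_k → 1` pointwise, then `F` is integrable. [folklore] -/
theorem integrable_of_forall_integral_cutoff_mul_le {μ : Measure α} {F : α → ℝ} {χ : ℕ → α → ℝ}
    (hF : AEStronglyMeasurable F μ) (hF0 : ∀ x, 0 ≤ F x) (hχ0 : ∀ k x, 0 ≤ χ k x)
    (hχF : ∀ k, Integrable (fun x ↦ χ k x * F x) μ)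
    (hlim : ∀ x, Tendsto (fun k ↦ χ k x) atTop (𝓝 1)) {K : ℝ}
    (hK : ∀ k, ∫ x, χ k x * F x ∂μ ≤ K) : Integrable F μ := by
  refine ⟨hF, ?_⟩
  rw [hasFiniteIntegral_iff_norm]
  have hpt : ∀ x, ENNReal.ofReal ‖F x‖ =
      liminf (fun k ↦ ENNReal.ofReal (χ k x * F x)) atTop := fun x ↦ by
    rw [Real.norm_eq_abs, abs_of_nonneg (hF0 x)]
    refine (((ENNReal.continuous_ofReal.tendsto _).comp ?_).liminf_eq).symm
    simpa using (hlim x).mul_const (F x)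
  calc ∫⁻ x, ENNReal.ofReal ‖F x‖ ∂μ
      = ∫⁻ x, liminf (fun k ↦ ENNReal.ofReal (χ k x * F x)) atTop ∂μ :=
        lintegral_congr fun x ↦ hpt x
    _ ≤ liminf (fun k ↦ ∫⁻ x, ENNReal.ofReal (χ k x * F x) ∂μ) atTop :=
        lintegral_liminf_le' fun k ↦
          (hχF k).aestronglyMeasurable.aemeasurable.ennreal_ofReal
    _ ≤ ENNReal.ofReal K := by
        refine liminf_le_of_frequently_le' (Frequently.of_forall fun k ↦ ?_)
        rw [← ofReal_integral_eq_lintegral_ofReal (hχF k)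
          (Eventually.of_forall fun x ↦ mul_nonneg (hχ0 k x) (hF0 x))]
        exact ENNReal.ofReal_le_ofReal (hK k)
    _ < ⊤ := ENNReal.ofReal_lt_top

end Fatou

section ProperIntegrability

variable {n : ℕ} {M : Type*} [TopologicalSpace M] [ChartedSpace (EuclideanSpace ℝ (Fin n)) M]
  [IsManifold (𝓡 n) ∞ M] [T3Space M] [MeasurableSpace M] [BorelSpace M]
  {g : PseudoRiemannianMetric (𝓡 n) ∞ (EuclideanSpace ℝ (Fin n)) (TangentSpace (𝓡 n) : M → Type _)}
  {f : M → ℝ}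

/-- A smooth NON-INCREASING cut-off profile: `φ = 1 − smoothTransition (· − 1)` is `C^∞`, equal
to `1` on `(−∞, 1]`, to `0` on `[2, ∞)`, valued in `[0, 1]`, and antitone (so `φ' ≤ 0`).
[folklore] -/
theorem exists_antitone_cutoffProfile :
    ∃ φ : ℝ → ℝ, ContDiff ℝ ∞ φ ∧ (∀ t ≤ 1, φ t = 1) ∧ (∀ t, 2 ≤ t → φ t = 0) ∧
      (∀ t, 0 ≤ φ t ∧ φ t ≤ 1) ∧ Antitone φ := by
  refine ⟨fun t ↦ 1 - Real.smoothTransition (t - 1), ?_, ?_, ?_, ?_, ?_⟩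
  · exact contDiff_const.sub (Real.smoothTransition.contDiff.comp (contDiff_id.sub contDiff_const))
  · intro t ht
    simp [Real.smoothTransition.zero_of_nonpos (by linarith : t - 1 ≤ 0)]
  · intro t ht
    simp [Real.smoothTransition.one_of_one_le (by linarith : 1 ≤ t - 1)]
  · intro t
    exact ⟨sub_nonneg.2 (Real.smoothTransition.le_one _),
      sub_le_self _ (Real.smoothTransition.nonneg _)⟩
  · intro a b hab
    exact sub_le_sub_left (Real.smoothTransition.monotone (by linarith)) 1

/-- On a Riemannian manifold the Riemannian measure is finite on compact sets
(`riemannianVolume_lt_top_of_isCompact_holds`). [folklore] -/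
theorem isFiniteMeasureOnCompacts_riemVolume (hg : g.IsRiemannian) :
    IsFiniteMeasureOnCompacts g.riemVolume := by
  rw [PseudoRiemannianMetric.riemVolume_eq hg]
  exact ⟨fun K hK ↦ riemannianVolume_lt_top_of_isCompact_holds _ le_rfl hK⟩

variable [g.HasLeviCivita]

/-- **The weighted-volume identity of a gradient shrinker, cut off** (the mechanism behind
Thm. 1.1 (i) / Cor. 2.1: "the integral involved in the normalization … [is] finite"): for `g`
Riemannian, `f` smooth and proper with `Ric + Hess f = g/2`, `S + |∇f|² = f`, and a smooth
non-increasing profile `φ` vanishing on `[2, ∞)`, for every `R > 0`,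
`∫ φ(f/R) (f − n/2) e^{-f} dV ≤ 0`. Indeed by Green's identity for the compactly supported
`φ(f/R)` and `Δ(e^{-f}) = (f − n/2) e^{-f}` (`dalembertian_exp_neg`, i.e. `Δ_f f = n/2 − f`),
`∫ φ(f/R) (f − n/2) e^{-f} = −∫ g⁻¹(dφ(f/R), d e^{-f}) = R⁻¹ ∫ φ'(f/R) |∇f|² e^{-f} ≤ 0`.
[cite: CarrilloNi2009, §2, (2.1)–(2.3) and Cor. 2.1] -/
theorem integral_cutoff_mul_sub_mul_exp_neg_nonpos (hg : g.IsRiemannian)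
    (hf : ContMDiff (𝓡 n) 𝓘(ℝ, ℝ) ∞ f)
    (hsol : ∀ (x : M) (X Y : TangentSpace (𝓡 n) x),
      g.ricci x X Y + g.hessian f x X Y = (1 / 2 : ℝ) * g.val x X Y)
    (hnorm : ∀ x : M, g.scalarCurvature x + g.gradSq f x = f x)
    (hprop : ∀ R : ℝ, IsCompact {x | f x ≤ R}) {φ : ℝ → ℝ} (hφs : ContDiff ℝ ∞ φ)
    (hφ0 : ∀ t, 2 ≤ t → φ t = 0) (hφa : Antitone φ) {R : ℝ} (hR : 0 < R) :
    ∫ x, φ (f x / R) * ((f x - n / 2) * Real.exp (-f x)) ∂g.riemVolume ≤ 0 := by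
  classical
  -- topology supplied by the exhaustion
  haveI : SigmaCompactSpace M := ⟨⟨fun k : ℕ ↦ {x | f x ≤ k}, fun k ↦ hprop k,
    eq_univ_of_forall fun x ↦ mem_iUnion.2 (exists_nat_ge (f x))⟩⟩
  haveI : WeaklyLocallyCompactSpace M := ⟨fun x ↦ ⟨{y | f y ≤ f x + 1}, hprop _, by
    have hopen : IsOpen {y | f y < f x + 1} := isOpen_lt hf.continuous continuous_const
    exact mem_of_superset (hopen.mem_nhds (show x ∈ {y | f y < f x + 1} from lt_add_one (f x)))
      fun y hy ↦ show f y ≤ f x + 1 from le_of_lt hy⟩⟩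
  -- the cut-off `χ = φ (f / R)`
  set ζ : ℝ → ℝ := fun t ↦ φ (t / R) with hζ
  have hζs : ContDiff ℝ ∞ ζ := hφs.comp (contDiff_id.div_const _)
  have hζd : ∀ t, HasDerivAt ζ (deriv φ (t / R) / R) t := fun t ↦ by
    have h1 : HasDerivAt (fun s : ℝ ↦ s / R) (1 / R) t := (hasDerivAt_id t).div_const _
    have h2 : HasDerivAt φ (deriv φ (t / R)) (t / R) :=
      (hφs.differentiable (by norm_num) _).hasDerivAt
    simpa [hζ, div_eq_mul_inv, Function.comp_def] using h2.comp t h1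
  set χ : M → ℝ := fun x ↦ ζ (f x) with hχ
  have hχs : ContMDiff (𝓡 n) 𝓘(ℝ, ℝ) 1 χ := (hζs.comp_contMDiff hf).of_le ENat.LEInfty.out
  have hχc : HasCompactSupport χ := by
    refine HasCompactSupport.intro (hprop (2 * R)) fun x hx ↦ ?_
    have hx' : 2 * R < f x := lt_of_not_ge hx
    exact hφ0 _ (by rw [le_div_iff₀ hR]; linarith)
  -- Green's identity for `χ` against `e^{-f}`
  have h2 : ContMDiff (𝓡 n) 𝓘(ℝ, ℝ) 2 (fun y ↦ Real.exp (-f y)) :=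
    ((Real.contDiff_exp.comp contDiff_neg).comp_contMDiff hf).of_le ENat.LEInfty.out
  have hGreen : ∫ x, χ x * g.dalembertian (fun y ↦ Real.exp (-f y)) x ∂g.riemVolume =
      -∫ x, g.innerDual x (mvfderiv (𝓡 n) χ x).toLinearMap
        (mvfderiv (𝓡 n) (fun y ↦ Real.exp (-f y)) x).toLinearMap ∂g.riemVolume := by
    haveI := (PseudoRiemannianMetric.ofRiemannian (g.toContMDiffRiemannianMetric hg)).hasLeviCivita
    have h1 := integral_mul_dalembertian_eq_neg_integral_innerDual_of_hasCompactSupport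
      (g.toContMDiffRiemannianMetric hg) hχs hχc h2
    rw [PseudoRiemannianMetric.riemVolume_eq hg]
    exact h1
  -- identify both integrands
  have hL : ∀ x, χ x * g.dalembertian (fun y ↦ Real.exp (-f y)) x =
      φ (f x / R) * ((f x - n / 2) * Real.exp (-f x)) := fun x ↦ by
    rw [dalembertian_exp_neg hsol hnorm hf x]
  have hRt : ∀ x, g.innerDual x (mvfderiv (𝓡 n) χ x).toLinearMap
      (mvfderiv (𝓡 n) (fun y ↦ Real.exp (-f y)) x).toLinearMap =
      -(deriv φ (f x / R) / R * (Real.exp (-f x) * g.gradSq f x)) := fun x ↦ by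
    have hfx : MDifferentiableAt (𝓡 n) 𝓘(ℝ, ℝ) f x := hf.mdifferentiableAt (by norm_num)
    have hdχ : (mvfderiv (𝓡 n) χ x).toLinearMap =
        (deriv φ (f x / R) / R) • (mvfderiv (𝓡 n) f x).toLinearMap := by
      ext v
      have := mvfderiv_real_comp_apply (I := 𝓡 n) (hζd (f x)) hfx v
      simpa [hχ, Function.comp_def] using this
    rw [hdχ]
    have h1 : g.innerDual x ((deriv φ (f x / R) / R) • (mvfderiv (𝓡 n) f x).toLinearMap)
        (mvfderiv (𝓡 n) (fun y ↦ Real.exp (-f y)) x).toLinearMap =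
        deriv φ (f x / R) / R * g.innerDual x (mvfderiv (𝓡 n) f x).toLinearMap
          (mvfderiv (𝓡 n) (fun y ↦ Real.exp (-f y)) x).toLinearMap := by
      simp only [PseudoRiemannianMetric.innerDual, LinearMap.smul_apply, smul_eq_mul]
    rw [h1, innerDual_mvfderiv_exp_neg hfx, PseudoRiemannianMetric.gradSq]
    ring
  simp_rw [hL, hRt, integral_neg, neg_neg] at hGreen
  rw [hGreen]
  refine integral_nonpos fun x ↦ ?_
  have hd : deriv φ (f x / R) ≤ 0 := hφa.deriv_nonpos
  have hG : 0 ≤ Real.exp (-f x) * g.gradSq f x :=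
    mul_nonneg (Real.exp_pos _).le (g.gradSq_nonneg hg f x)
  exact mul_nonpos_of_nonpos_of_nonneg (div_nonpos_of_nonpos_of_nonneg hd hR.le) hG

/-- **Thm. 1.1 (i) from properness alone: `e^{-f}` and `f e^{-f}` are integrable on a gradient
shrinker whose potential is proper** (the content of Cor. 2.1 that the sharpness clause and the
normalisation need, obtained here WITHOUT the growth estimates of Lemma 2.1 or the weighted volume
comparison of [WW]: from `integral_cutoff_mul_sub_mul_exp_neg_nonpos`, `∫ χ_R f e^{-f} ≤ (n/2)
∫ χ_R e^{-f}` for the cut-offs `χ_R = φ(f/R)`, whence `∫ χ_R e^{-f} ≤ 2 ∫_{f ≤ n+1} e^{-f} +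
(2/(n+1)) ∫_{f ≤ n+1} |f| e^{-f}` uniformly in `R`, and Fatou). [cite: CarrilloNi2009, Thm. 1.1 (i) and Cor. 2.1] -/
theorem integrable_exp_neg_of_proper (hg : g.IsRiemannian) (hf : ContMDiff (𝓡 n) 𝓘(ℝ, ℝ) ∞ f)
    (hsol : ∀ (x : M) (X Y : TangentSpace (𝓡 n) x),
      g.ricci x X Y + g.hessian f x X Y = (1 / 2 : ℝ) * g.val x X Y)
    (hnorm : ∀ x : M, g.scalarCurvature x + g.gradSq f x = f x)
    (hprop : ∀ R : ℝ, IsCompact {x | f x ≤ R}) :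
    Integrable (fun x ↦ Real.exp (-f x)) g.riemVolume ∧
      Integrable (fun x ↦ f x * Real.exp (-f x)) g.riemVolume := by
  classical
  haveI := isFiniteMeasureOnCompacts_riemVolume hg
  obtain ⟨φ, hφs, hφ1, hφ0, hφ01, hφa⟩ := exists_antitone_cutoffProfile
  -- notation
  set E : M → ℝ := fun x ↦ Real.exp (-f x) with hEdef
  have hE : Continuous E := Real.continuous_exp.comp hf.continuous.neg
  have hE0 : ∀ x, 0 < E x := fun x ↦ Real.exp_pos _
  set m : ℝ := n + 1 with hm
  have hm0 : 0 < m := by positivity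
  set A : Set M := {x | f x ≤ m} with hA
  have hAc : IsCompact A := hprop m
  have hAm : MeasurableSet A := (isClosed_le hf.continuous continuous_const).measurableSet
  -- the two constants `C₀ = ∫_A e^{-f}`, `C₁ = ∫_A |f| e^{-f}`
  have hC₀i : Integrable (A.indicator E) g.riemVolume :=
    (hE.continuousOn.integrableOn_compact hAc).integrable_indicator hAm
  have hC₁i : Integrable (A.indicator fun x ↦ |f x| * E x) g.riemVolume :=
    ((continuous_abs.comp hf.continuous).mul hE).continuousOn.integrableOn_compact hAc
      |>.integrable_indicator hAm
  set C₀ : ℝ := ∫ x, A.indicator E x ∂g.riemVolume with hC₀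
  set C₁ : ℝ := ∫ x, A.indicator (fun x ↦ |f x| * E x) x ∂g.riemVolume with hC₁
  -- the cut-offs
  set χ : ℕ → M → ℝ := fun k x ↦ φ (f x / (k + 1)) with hχ
  have hχcont : ∀ k, Continuous (χ k) := fun k ↦
    hφs.continuous.comp (hf.continuous.div_const _)
  have hχc : ∀ k : ℕ, HasCompactSupport (χ k) := fun k ↦ by
    refine HasCompactSupport.intro (hprop (2 * (k + 1))) fun x hx ↦ ?_
    have hx' : 2 * ((k : ℝ) + 1) < f x := lt_of_not_ge hx
    have hk : (0 : ℝ) < k + 1 := by positivity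
    exact hφ0 _ (by rw [le_div_iff₀ hk]; linarith)
  have hχ0 : ∀ k x, 0 ≤ χ k x := fun k x ↦ (hφ01 _).1
  have hχ1 : ∀ k x, χ k x ≤ 1 := fun k x ↦ (hφ01 _).2
  have hχlim : ∀ x, Tendsto (fun k ↦ χ k x) atTop (𝓝 1) := fun x ↦ by
    refine tendsto_const_nhds.congr' ?_
    obtain ⟨N, hN⟩ := exists_nat_ge (f x)
    filter_upwards [eventually_ge_atTop N] with k hk
    refine (hφ1 _ ?_).symm
    rw [div_le_one (by positivity)]
    calc f x ≤ N := hN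
      _ ≤ k := by exact_mod_cast hk
      _ ≤ k + 1 := by linarith
  have iE : ∀ k, Integrable (fun x ↦ χ k x * E x) g.riemVolume := fun k ↦
    ((hχcont k).mul hE).integrable_of_hasCompactSupport (hχc k).mul_right
  have ifE : ∀ k, Integrable (fun x ↦ χ k x * (f x * E x)) g.riemVolume := fun k ↦
    ((hχcont k).mul (hf.continuous.mul hE)).integrable_of_hasCompactSupport (hχc k).mul_right
  have iaE : ∀ k, Integrable (fun x ↦ χ k x * (|f x| * E x)) g.riemVolume := fun k ↦
    ((hχcont k).mul ((continuous_abs.comp hf.continuous).mul hE)).integrable_of_hasCompactSupport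
      (hχc k).mul_right
  -- the key inequality `∫ χ_k f e^{-f} ≤ (n/2) ∫ χ_k e^{-f}`
  have hkey : ∀ k, ∫ x, χ k x * (f x * E x) ∂g.riemVolume ≤
      (n : ℝ) / 2 * ∫ x, χ k x * E x ∂g.riemVolume := fun k ↦ by
    have h := integral_cutoff_mul_sub_mul_exp_neg_nonpos hg hf hsol hnorm hprop hφs hφ0 hφa
      (R := (k : ℝ) + 1) (by positivity)
    have hsplit : ∀ x, φ (f x / ((k : ℝ) + 1)) * ((f x - n / 2) * Real.exp (-f x)) =
        χ k x * (f x * E x) - (n : ℝ) / 2 * (χ k x * E x) := fun x ↦ by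
      simp only [hχ, hEdef]
      ring
    simp_rw [hsplit] at h
    rw [integral_sub (ifE k) ((iE k).const_mul _), integral_const_mul] at h
    linarith
  -- `I_k ≤ 2 (C₀ + C₁/m)`
  have hI : ∀ k, ∫ x, χ k x * E x ∂g.riemVolume ≤ 2 * (C₀ + m⁻¹ * C₁) := fun k ↦ by
    have hpt : ∀ x, χ k x * E x ≤ A.indicator E x + m⁻¹ * A.indicator (fun x ↦ |f x| * E x) x +
        m⁻¹ * (χ k x * (f x * E x)) := fun x ↦ by
      by_cases hx : x ∈ A
      · rw [indicator_of_mem hx, indicator_of_mem hx]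
        have h1 : χ k x * E x ≤ E x := mul_le_of_le_one_left (hE0 x).le (hχ1 k x)
        have h2 : 0 ≤ m⁻¹ * (|f x| * E x) + m⁻¹ * (χ k x * (f x * E x)) := by
          rw [← mul_add]
          refine mul_nonneg (inv_nonneg.2 hm0.le) ?_
          have : -(|f x|) ≤ χ k x * f x := by
            have h3 : |χ k x * f x| ≤ |f x| := by
              rw [abs_mul, abs_of_nonneg (hχ0 k x)]
              exact mul_le_of_le_one_left (abs_nonneg _) (hχ1 k x)
            linarith [neg_abs_le (χ k x * f x)]
          nlinarith [hE0 x]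
        linarith
      · rw [indicator_of_notMem hx, indicator_of_notMem hx]
        have hfx : m < f x := lt_of_not_ge hx
        have h1 : 1 ≤ m⁻¹ * f x := by
          rw [inv_mul_eq_div, le_div_iff₀ hm0]; linarith
        have h2 : 0 ≤ χ k x * E x := mul_nonneg (hχ0 k x) (hE0 x).le
        nlinarith
    have h1 : ∫ x, χ k x * E x ∂g.riemVolume ≤
        C₀ + m⁻¹ * C₁ + m⁻¹ * ∫ x, χ k x * (f x * E x) ∂g.riemVolume := by
      have i1 : Integrable (fun x ↦ m⁻¹ * A.indicator (fun x ↦ |f x| * E x) x) g.riemVolume :=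
        hC₁i.const_mul _
      have i2 : Integrable (fun x ↦ m⁻¹ * (χ k x * (f x * E x))) g.riemVolume := (ifE k).const_mul _
      have i3 : Integrable (fun x ↦ A.indicator E x + m⁻¹ * A.indicator (fun x ↦ |f x| * E x) x)
          g.riemVolume := hC₀i.add i1
      calc ∫ x, χ k x * E x ∂g.riemVolume
          ≤ ∫ x, (A.indicator E x + m⁻¹ * A.indicator (fun x ↦ |f x| * E x) x +
              m⁻¹ * (χ k x * (f x * E x))) ∂g.riemVolume :=
            integral_mono (iE k) (i3.add i2) hpt
        _ = C₀ + m⁻¹ * C₁ + m⁻¹ * ∫ x, χ k x * (f x * E x) ∂g.riemVolume := by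
            rw [integral_add i3 i2, integral_add hC₀i i1, integral_const_mul, integral_const_mul]
    have h2 := hkey k
    have hIpos : 0 ≤ ∫ x, χ k x * E x ∂g.riemVolume :=
      integral_nonneg fun x ↦ mul_nonneg (hχ0 k x) (hE0 x).le
    have h3 : m⁻¹ * ((n : ℝ) / 2 * ∫ x, χ k x * E x ∂g.riemVolume) ≤
        1 / 2 * ∫ x, χ k x * E x ∂g.riemVolume := by
      rw [← mul_assoc]
      refine mul_le_mul_of_nonneg_right ?_ hIpos
      rw [inv_mul_le_iff₀ hm0]
      simp only [hm]
      linarith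
    have h4 : m⁻¹ * ∫ x, χ k x * (f x * E x) ∂g.riemVolume ≤
        m⁻¹ * ((n : ℝ) / 2 * ∫ x, χ k x * E x ∂g.riemVolume) :=
      mul_le_mul_of_nonneg_left h2 (inv_nonneg.2 hm0.le)
    linarith
  -- `∫ χ_k |f| e^{-f} ≤ n (C₀ + C₁/m) + 2 C₁`
  have hJ : ∀ k, ∫ x, χ k x * (|f x| * E x) ∂g.riemVolume ≤
      (n : ℝ) * (C₀ + m⁻¹ * C₁) + 2 * C₁ := fun k ↦ by
    have hpt : ∀ x, χ k x * (|f x| * E x) ≤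
        χ k x * (f x * E x) + 2 * A.indicator (fun x ↦ |f x| * E x) x := fun x ↦ by
      rcases le_or_gt 0 (f x) with hfx | hfx
      · rw [abs_of_nonneg hfx]
        have : 0 ≤ A.indicator (fun x ↦ |f x| * E x) x :=
          indicator_nonneg (fun y _ ↦ mul_nonneg (abs_nonneg _) (hE0 y).le) x
        linarith
      · have hxA : x ∈ A := show f x ≤ m by linarith
        rw [indicator_of_mem hxA, abs_of_neg hfx]
        have key : 0 ≤ (1 - χ k x) * (-f x * E x) :=
          mul_nonneg (sub_nonneg.2 (hχ1 k x)) (mul_nonneg (neg_nonneg.2 hfx.le) (hE0 x).le)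
        calc χ k x * (-f x * E x)
            ≤ χ k x * (-f x * E x) + 2 * ((1 - χ k x) * (-f x * E x)) :=
              le_add_of_nonneg_right (mul_nonneg zero_le_two key)
          _ = χ k x * (f x * E x) + 2 * (-f x * E x) := by ring
    have i2 : Integrable (fun x ↦ 2 * A.indicator (fun x ↦ |f x| * E x) x) g.riemVolume :=
      hC₁i.const_mul _
    calc ∫ x, χ k x * (|f x| * E x) ∂g.riemVolume
        ≤ ∫ x, (χ k x * (f x * E x) + 2 * A.indicator (fun x ↦ |f x| * E x) x) ∂g.riemVolume :=
          integral_mono (iaE k) ((ifE k).add i2) hpt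
      _ = ∫ x, χ k x * (f x * E x) ∂g.riemVolume + 2 * C₁ := by
          rw [integral_add (ifE k) i2, integral_const_mul]
      _ ≤ (n : ℝ) / 2 * ∫ x, χ k x * E x ∂g.riemVolume + 2 * C₁ := by linarith [hkey k]
      _ ≤ (n : ℝ) / 2 * (2 * (C₀ + m⁻¹ * C₁)) + 2 * C₁ := by
          gcongr
          exact hI k
      _ = (n : ℝ) * (C₀ + m⁻¹ * C₁) + 2 * C₁ := by ring
  -- Fatou
  have intE : Integrable E g.riemVolume :=
    integrable_of_forall_integral_cutoff_mul_le hE.aestronglyMeasurable (fun x ↦ (hE0 x).le)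
      hχ0 iE hχlim hI
  have intA : Integrable (fun x ↦ |f x| * E x) g.riemVolume :=
    integrable_of_forall_integral_cutoff_mul_le
      ((continuous_abs.comp hf.continuous).mul hE).aestronglyMeasurable
      (fun x ↦ mul_nonneg (abs_nonneg _) (hE0 x).le) hχ0 iaE hχlim hJ
  refine ⟨intE, intA.mono (hf.continuous.mul hE).aestronglyMeasurable
    (Eventually.of_forall fun x ↦ ?_)⟩
  rw [Real.norm_eq_abs, Real.norm_eq_abs, abs_mul, abs_mul, abs_abs]

/-- **Thm. 1.1 (i) on a gradient shrinker with proper potential**: `e^{-f}` is integrable and the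
shift `f + log Θ` is compatible, `∫ (4π)^{-n/2} e^{-(f + log Θ)} dV = 1` — i.e. clause (i) of
`CarrilloNi2009_shrinkerLSI` granted only the properness of `f` (Lemma 2.1: `f ≥ (r − C₁)²/4`).
[cite: CarrilloNi2009, Thm. 1.1 (i)] -/
theorem clause_i_of_proper [Nonempty M] (hg : g.IsRiemannian)
    (hf : ContMDiff (𝓡 n) 𝓘(ℝ, ℝ) ∞ f)
    (hsol : ∀ (x : M) (X Y : TangentSpace (𝓡 n) x),
      g.ricci x X Y + g.hessian f x X Y = (1 / 2 : ℝ) * g.val x X Y)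
    (hnorm : ∀ x : M, g.scalarCurvature x + g.gradSq f x = f x)
    (hprop : ∀ R : ℝ, IsCompact {x | f x ≤ R}) :
    Integrable (fun x ↦ Real.exp (-f x)) g.riemVolume ∧
      g.IsEntropyCompatible (fun y ↦ f y +
        Real.log ((4 * Real.pi) ^ (-(n : ℝ) / 2) * ∫ x, Real.exp (-f x) ∂g.riemVolume)) 1 :=
  ⟨(integrable_exp_neg_of_proper hg hf hsol hnorm hprop).1,
    isEntropyCompatible_add_log hg (integrable_exp_neg_of_proper hg hf hsol hnorm hprop).1⟩

/-- **`S e^{-f}` and `|∇f|² e^{-f}` are integrable once `S` is bounded below** on a shrinker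
with proper potential: `S ≤ f` (as `|∇f|² ≥ 0`) and `−B ≤ S` give `|S| ≤ |f| + |B|`, and
`|∇f|² = f − S`; `f e^{-f}`, `e^{-f}` are integrable (`integrable_exp_neg_of_proper`). With Chen's
`S ≥ 0` ([Ch], quoted in the proof of Lemma 2.1) one takes `B = 0`.
[cite: CarrilloNi2009, Lemma 2.1 and Cor. 2.1 (with [Ch])] -/
theorem integrable_gradSq_mul_exp_neg_of_proper (hg : g.IsRiemannian)
    (hf : ContMDiff (𝓡 n) 𝓘(ℝ, ℝ) ∞ f)
    (hsol : ∀ (x : M) (X Y : TangentSpace (𝓡 n) x),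
      g.ricci x X Y + g.hessian f x X Y = (1 / 2 : ℝ) * g.val x X Y)
    (hnorm : ∀ x : M, g.scalarCurvature x + g.gradSq f x = f x)
    (hprop : ∀ R : ℝ, IsCompact {x | f x ≤ R}) {B : ℝ} (hS : ∀ x, -B ≤ g.scalarCurvature x) :
    Integrable (fun x ↦ g.scalarCurvature x * Real.exp (-f x)) g.riemVolume ∧
      Integrable (fun x ↦ g.gradSq f x * Real.exp (-f x)) g.riemVolume := by
  obtain ⟨hint, hfint⟩ := integrable_exp_neg_of_proper hg hf hsol hnorm hprop
  have hSc : Continuous fun x ↦ g.scalarCurvature x :=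
    (PseudoRiemannianMetric.contMDiff_scalarCurvature g).continuous
  have hE : Continuous fun x ↦ Real.exp (-f x) := Real.continuous_exp.comp hf.continuous.neg
  have hSle : ∀ x, g.scalarCurvature x ≤ f x := fun x ↦ by
    linarith [hnorm x, g.gradSq_nonneg hg f x]
  have imaj : Integrable (fun x ↦ |f x| * Real.exp (-f x) + |B| * Real.exp (-f x))
      g.riemVolume :=
    (hfint.norm.add (hint.const_mul |B|)).congr (Eventually.of_forall fun x ↦ by
      simp only [Pi.add_apply, Real.norm_eq_abs, abs_mul, abs_of_pos (Real.exp_pos _)])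
  have iS : Integrable (fun x ↦ g.scalarCurvature x * Real.exp (-f x)) g.riemVolume := by
    refine imaj.mono (hSc.mul hE).aestronglyMeasurable (Eventually.of_forall fun x ↦ ?_)
    have hpos : 0 < Real.exp (-f x) := Real.exp_pos _
    have habs : |g.scalarCurvature x| ≤ |f x| + |B| := by
      rw [abs_le]
      constructor
      · linarith [hS x, le_abs_self B, abs_nonneg (f x)]
      · linarith [hSle x, le_abs_self (f x), abs_nonneg B]
    have h0 : 0 ≤ |f x| * Real.exp (-f x) + |B| * Real.exp (-f x) := by positivity
    rw [Real.norm_eq_abs, abs_mul, abs_of_pos hpos, Real.norm_eq_abs, abs_of_nonneg h0]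
    nlinarith
  refine ⟨iS, (hfint.sub iS).congr (Eventually.of_forall fun x ↦ ?_)⟩
  show f x * Real.exp (-f x) - g.scalarCurvature x * Real.exp (-f x) =
    g.gradSq f x * Real.exp (-f x)
  rw [← sub_mul]
  congr 1
  linarith [hnorm x]

/-- **Clauses (i) and (iii) of `CarrilloNi2009_shrinkerLSI`, and `μ(g, 1) ≤ log Θ`, on a gradient
shrinker with PROPER potential and scalar curvature BOUNDED BELOW** — i.e. granted the lower growth
bound of Lemma 2.1 (`f ≥ (r − C₁)²/4`, after [FMZ]/[CZh]: properness) and Chen's `S ≥ 0` ([Ch];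
any lower bound suffices): integrability and normalisation of `e^{-f}`, the sharp value
`𝒲(g, f + log Θ, 1) = log Θ`, and `μ(g, 1) ≤ log Θ`. [cite: CarrilloNi2009, Thm. 1.1 (i), §4 and Cor. 4.1 (with Lemma 2.1, [Ch])] -/
theorem clauses_i_iii_of_proper [Nonempty M] (hg : g.IsRiemannian)
    (hf : ContMDiff (𝓡 n) 𝓘(ℝ, ℝ) ∞ f)
    (hsol : ∀ (x : M) (X Y : TangentSpace (𝓡 n) x),
      g.ricci x X Y + g.hessian f x X Y = (1 / 2 : ℝ) * g.val x X Y)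
    (hnorm : ∀ x : M, g.scalarCurvature x + g.gradSq f x = f x)
    (hprop : ∀ R : ℝ, IsCompact {x | f x ≤ R}) {B : ℝ} (hS : ∀ x, -B ≤ g.scalarCurvature x) :
    Integrable (fun x ↦ Real.exp (-f x)) g.riemVolume ∧
    g.IsEntropyCompatible (fun y ↦ f y +
        Real.log ((4 * Real.pi) ^ (-(n : ℝ) / 2) * ∫ x, Real.exp (-f x) ∂g.riemVolume)) 1 ∧
    g.wEntropy g.leviCivita (fun y ↦ f y +
        Real.log ((4 * Real.pi) ^ (-(n : ℝ) / 2) * ∫ x, Real.exp (-f x) ∂g.riemVolume)) 1 =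
      Real.log ((4 * Real.pi) ^ (-(n : ℝ) / 2) * ∫ x, Real.exp (-f x) ∂g.riemVolume) ∧
    g.muEntropy g.leviCivita 1 ≤
      ((Real.log ((4 * Real.pi) ^ (-(n : ℝ) / 2) * ∫ x, Real.exp (-f x) ∂g.riemVolume) : ℝ) :
        EReal) := by
  obtain ⟨hint, hfint⟩ := integrable_exp_neg_of_proper hg hf hsol hnorm hprop
  have hgint := (integrable_gradSq_mul_exp_neg_of_proper hg hf hsol hnorm hprop hS).2
  exact ⟨hint, isEntropyCompatible_add_log hg hint,
    wEntropy_add_log_eq_of_proper hg hf hsol hnorm hprop hint hfint hgint,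
    muEntropy_le_log_of_proper hg hf hsol hnorm hprop hint hfint hgint⟩

end ProperIntegrability

section GrowthFromCurvatureBound

variable {n : ℕ} {M : Type*} [TopologicalSpace M] [ChartedSpace (EuclideanSpace ℝ (Fin n)) M]
  [IsManifold (𝓡 n) ∞ M] [T3Space M]
  {g : PseudoRiemannianMetric (𝓡 n) ∞ (EuclideanSpace ℝ (Fin n)) (TangentSpace (𝓡 n) : M → Type _)}
  [g.HasLeviCivita] {f : M → ℝ}

omit [g.HasLeviCivita] in
/-- **On a connected Riemannian manifold the distance is finite**: the set `{d(x, ·) < ∞}` is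
open (a ball) and closed (its complement is a union of unit balls, by the triangle inequality),
and contains `x`. [folklore] -/
theorem riemEDist_lt_top [PreconnectedSpace M] (hg : g.IsRiemannian) (x y : M) :
    g.riemEDist x y < ⊤ := by
  have hopen : IsOpen {z | g.riemEDist x z < ⊤} := PseudoRiemannianMetric.isOpen_ball hg x ⊤
  have hclosed : IsClosed {z | g.riemEDist x z < ⊤} := by
    rw [← isOpen_compl_iff, isOpen_iff_mem_nhds]
    intro z hz
    have hz' : g.riemEDist x z = ⊤ := by
      simpa [mem_compl_iff, mem_setOf_eq, lt_top_iff_ne_top] using hz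
    have hnhds : {w | g.edist hg z w < 1} ∈ 𝓝 z :=
      PseudoRiemannianMetric.setOf_edist_lt_mem_nhds hg z one_pos
    refine mem_of_superset hnhds fun w hw ↦ ?_
    simp only [mem_compl_iff, mem_setOf_eq, not_lt, top_le_iff]
    by_contra hxw
    have htri := PseudoRiemannianMetric.edist_triangle hg x w z
    rw [PseudoRiemannianMetric.riemEDist_eq hg] at hz' hxw
    rw [hz', PseudoRiemannianMetric.edist_comm hg w z] at htri
    have hfin : g.edist hg x w + g.edist hg z w < ⊤ :=
      ENNReal.add_lt_top.2 ⟨lt_top_iff_ne_top.2 hxw, (mem_setOf_eq ▸ hw).trans ENNReal.one_lt_top⟩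
    exact (lt_irrefl _ (htri.trans_lt hfin))
  have hclopen : IsClopen {z | g.riemEDist x z < ⊤} := ⟨hclosed, hopen⟩
  have huniv := hclopen.eq_univ ⟨x, by
    simp [PseudoRiemannianMetric.riemEDist_eq hg, PseudoRiemannianMetric.edist_self]⟩
  have hy : y ∈ {z | g.riemEDist x z < ⊤} := huniv ▸ mem_univ y
  exact hy

/-- **`√(f + B + 1)` is `½`-Lipschitz on a gradient shrinker with `S ≥ −B`** (the mechanism of
the upper bound of Lemma 2.1, "(2.6): `|∇f| ≤ √((f + μ_s)/τ)` … integrating `f + μ_s` along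
minimizing geodesics"; here without geodesics, by integrating the differential bound along
almost-minimising curves, `ofReal_abs_sub_le_mul_riemEDist`): from `S + |∇f|² = f` and `S ≥ −B`,
`|∇f|² ≤ f + B < f + B + 1`, so `|d√(f + B + 1)| ≤ ½ |·|_g`.
[cite: CarrilloNi2009, Lemma 2.1, (2.5)–(2.6)] -/
theorem ofReal_abs_sqrt_sub_sqrt_le [PreconnectedSpace M] (hg : g.IsRiemannian)
    (hf : ContMDiff (𝓡 n) 𝓘(ℝ, ℝ) ∞ f)
    (hnorm : ∀ x : M, g.scalarCurvature x + g.gradSq f x = f x) {B : ℝ}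
    (hS : ∀ x, -B ≤ g.scalarCurvature x) (x y : M) :
    ENNReal.ofReal |Real.sqrt (f x + (B + 1)) - Real.sqrt (f y + (B + 1))| ≤
      ((1 / 2 : ℝ≥0) : ℝ≥0∞) * g.riemEDist x y := by
  have hpos : ∀ z, 0 < f z + (B + 1) := fun z ↦ by
    linarith [hnorm z, hS z, g.gradSq_nonneg hg f z]
  set h : M → ℝ := fun z ↦ Real.sqrt (f z + (B + 1)) with hh
  -- `h` is `C¹`
  have hh1 : ContMDiffOn (𝓡 n) 𝓘(ℝ, ℝ) 1 h univ := fun z _ ↦ by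
    have hζ : ContDiffAt ℝ 1 (fun s : ℝ ↦ Real.sqrt (s + (B + 1))) (f z) := by
      have h1 : ContDiffAt ℝ 1 (fun s : ℝ ↦ s + (B + 1)) (f z) := contDiffAt_id.add contDiffAt_const
      exact (Real.contDiffAt_sqrt (hpos z).ne').comp (f z) h1
    have hfz : ContMDiffAt (𝓡 n) 𝓘(ℝ, ℝ) 1 f z := (hf.of_le ENat.LEInfty.out).contMDiffAt
    exact ((contMDiffAt_iff_contDiffAt.2 hζ).comp z hfz).contMDiffWithinAt
  -- the differential bound `|dh(v)| ≤ ½ |v|`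
  have hL : ∀ z ∈ (univ : Set M), ∀ v : TangentSpace (𝓡 n) z,
      |mvfderiv (𝓡 n) h z v| ≤ ((1 / 2 : ℝ≥0) : ℝ) * Real.sqrt (g.val z v v) := by
    intro z _ v
    have hfz : MDifferentiableAt (𝓡 n) 𝓘(ℝ, ℝ) f z := hf.mdifferentiableAt (by norm_num)
    have hd : HasDerivAt (fun s : ℝ ↦ Real.sqrt (s + (B + 1)))
        (1 / (2 * Real.sqrt (f z + (B + 1)))) (f z) := by
      simpa using ((hasDerivAt_id (f z)).add_const (B + 1)).sqrt (hpos z).ne'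
    have hcomp := mvfderiv_real_comp_apply (I := 𝓡 n) hd hfz v
    have hsq : 0 < Real.sqrt (f z + (B + 1)) := Real.sqrt_pos.2 (hpos z)
    have hCS := abs_mvfderiv_le_sqrt_gradSq_mul_sqrt g hg f z v
    have hgrad : Real.sqrt (g.gradSq f z) ≤ Real.sqrt (f z + (B + 1)) :=
      Real.sqrt_le_sqrt (by linarith [hnorm z, hS z])
    have hvv : 0 ≤ Real.sqrt (g.val z v v) := Real.sqrt_nonneg _
    rw [show h = (fun s : ℝ ↦ Real.sqrt (s + (B + 1))) ∘ f from rfl, hcomp, abs_mul,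
      abs_of_pos (by positivity : 0 < 1 / (2 * Real.sqrt (f z + (B + 1))))]
    calc 1 / (2 * Real.sqrt (f z + (B + 1))) * |mvfderiv (𝓡 n) f z v|
        ≤ 1 / (2 * Real.sqrt (f z + (B + 1))) *
            (Real.sqrt (f z + (B + 1)) * Real.sqrt (g.val z v v)) := by
          gcongr
          exact hCS.trans (mul_le_mul_of_nonneg_right hgrad hvv)
      _ = ((1 / 2 : ℝ≥0) : ℝ) * Real.sqrt (g.val z v v) := by
          have h12 : ((1 / 2 : ℝ≥0) : ℝ) = 1 / 2 := by norm_num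
          rw [h12]
          field_simp
  have hy : y ∈ g.ball x ⊤ := riemEDist_lt_top hg x y
  exact ofReal_abs_sub_le_mul_riemEDist g hg isOpen_univ hh1 hL (subset_univ _) hy

/-- **The upper growth bound of Lemma 2.1 from `S ≥ −B`**: `f(x) + B + 1 ≤ 2 (f(o) + B + 1) +
d(o, x)²/2` for all `o, x` on a connected gradient shrinker (`√(f + B + 1)` is `½`-Lipschitz,
`ofReal_abs_sqrt_sub_sqrt_le`, and `(a + b)² ≤ 2a² + 2b²`). The printed bound is
`f ≤ (r + C₁)²/(4τ)`. [cite: CarrilloNi2009, Lemma 2.1, (2.5)] -/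
theorem potential_le_of_scalarCurvature_ge [PreconnectedSpace M] (hg : g.IsRiemannian)
    (hf : ContMDiff (𝓡 n) 𝓘(ℝ, ℝ) ∞ f)
    (hnorm : ∀ x : M, g.scalarCurvature x + g.gradSq f x = f x) {B : ℝ}
    (hS : ∀ x, -B ≤ g.scalarCurvature x) (o x : M) :
    f x + (B + 1) ≤ 2 * (f o + (B + 1)) + (g.riemEDist o x).toReal ^ 2 / 2 := by
  have hpos : ∀ z, 0 < f z + (B + 1) := fun z ↦ by
    linarith [hnorm z, hS z, g.gradSq_nonneg hg f z]
  have hlt := riemEDist_lt_top hg o x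
  have h := ofReal_abs_sqrt_sub_sqrt_le hg hf hnorm hS x o
  have hsymm : g.riemEDist x o = g.riemEDist o x := by
    rw [PseudoRiemannianMetric.riemEDist_eq hg, PseudoRiemannianMetric.riemEDist_eq hg,
      PseudoRiemannianMetric.edist_comm hg]
  rw [hsymm] at h
  set d : ℝ := (g.riemEDist o x).toReal with hd
  have hd0 : 0 ≤ d := ENNReal.toReal_nonneg
  have hdist : g.riemEDist o x = ENNReal.ofReal d := (ENNReal.ofReal_toReal hlt.ne).symm
  rw [hdist, ENNReal.coe_nnreal_eq, ← ENNReal.ofReal_mul (by positivity),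
    ENNReal.ofReal_le_ofReal_iff (by positivity)] at h
  push_cast at h
  have hab := (abs_le.1 h).2
  set a := Real.sqrt (f x + (B + 1))
  set b := Real.sqrt (f o + (B + 1))
  have ha : a ^ 2 = f x + (B + 1) := Real.sq_sqrt (hpos x).le
  have hb : b ^ 2 = f o + (B + 1) := Real.sq_sqrt (hpos o).le
  have hb0 : 0 ≤ b := Real.sqrt_nonneg _
  have ha0 : 0 ≤ a := Real.sqrt_nonneg _
  have h1 : a ≤ b + d / 2 := by linarith
  have h2 : a ^ 2 ≤ (b + d / 2) ^ 2 := pow_le_pow_left₀ ha0 h1 2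
  nlinarith [h2, ha, hb, sq_nonneg (b - d / 2)]

variable [MeasurableSpace M] [BorelSpace M]

/-- **`f u` and `S u` are integrable for a density of bounded second moment** on a connected
gradient shrinker with `S ≥ −B` (`f + B + 1 ≤ 2 (f(o) + B + 1) + d(o, ·)²/2` by
`potential_le_of_scalarCurvature_ge`, `f ≥ −B`, `−B ≤ S ≤ f`): the integrability provisos
on the test density in `log_le_wEntropy_of_lsi`. [cite: CarrilloNi2009, Lemma 2.1 and §4] -/
theorem integrable_potential_mul_of_secondMoment [PreconnectedSpace M] (hg : g.IsRiemannian)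
    (hf : ContMDiff (𝓡 n) 𝓘(ℝ, ℝ) ∞ f)
    (hnorm : ∀ x : M, g.scalarCurvature x + g.gradSq f x = f x) {B : ℝ}
    (hS : ∀ x, -B ≤ g.scalarCurvature x) {u : M → ℝ} (hu : Continuous u)
    (hu0 : ∀ x, 0 ≤ u x) (huI : Integrable u g.riemVolume) {o : M}
    (h2 : Integrable (fun x ↦ (g.riemEDist o x).toReal ^ 2 * u x) g.riemVolume) :
    Integrable (fun x ↦ f x * u x) g.riemVolume ∧
      Integrable (fun x ↦ g.scalarCurvature x * u x) g.riemVolume := by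
  have hflo : ∀ x, -B ≤ f x := fun x ↦ by linarith [hnorm x, hS x, g.gradSq_nonneg hg f x]
  have hSle : ∀ x, g.scalarCurvature x ≤ f x := fun x ↦ by
    linarith [hnorm x, g.gradSq_nonneg hg f x]
  have hgrow := potential_le_of_scalarCurvature_ge hg hf hnorm hS o
  set K : ℝ := |B| + 2 * |f o + (B + 1)| + |B + 1| with hK
  have hK0 : 0 ≤ K := by rw [hK]; positivity
  have habsf : ∀ x, |f x| ≤ K + (g.riemEDist o x).toReal ^ 2 / 2 := fun x ↦ by
    rw [abs_le]
    constructor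
    · have : 0 ≤ (g.riemEDist o x).toReal ^ 2 / 2 := by positivity
      linarith [hflo x, le_abs_self B, abs_nonneg (f o + (B + 1)), abs_nonneg (B + 1)]
    · linarith [hgrow x, le_abs_self (f o + (B + 1)), abs_nonneg B, neg_le_abs (B + 1)]
  have imaj : Integrable (fun x ↦ K * u x + 1 / 2 * ((g.riemEDist o x).toReal ^ 2 * u x))
      g.riemVolume := (huI.const_mul K).add (h2.const_mul _)
  have hfu : Integrable (fun x ↦ f x * u x) g.riemVolume := by
    refine imaj.mono (hf.continuous.mul hu).aestronglyMeasurable (Eventually.of_forall fun x ↦ ?_)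
    have h0 : 0 ≤ K * u x + 1 / 2 * ((g.riemEDist o x).toReal ^ 2 * u x) :=
      add_nonneg (mul_nonneg hK0 (hu0 x))
        (mul_nonneg (by norm_num) (mul_nonneg (sq_nonneg _) (hu0 x)))
    rw [Real.norm_eq_abs, Real.norm_eq_abs, abs_mul, abs_of_nonneg (hu0 x), abs_of_nonneg h0]
    nlinarith [habsf x, hu0 x]
  refine ⟨hfu, ?_⟩
  have imaj2 : Integrable (fun x ↦ |f x| * u x + |B| * u x) g.riemVolume :=
    (hfu.norm.congr (Eventually.of_forall fun x ↦ by
      simp only [Real.norm_eq_abs, abs_mul, abs_of_nonneg (hu0 x)])).add (huI.const_mul _)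
  refine imaj2.mono ((PseudoRiemannianMetric.contMDiff_scalarCurvature g).continuous.mul
    hu).aestronglyMeasurable (Eventually.of_forall fun x ↦ ?_)
  have habs : |g.scalarCurvature x| ≤ |f x| + |B| := by
    rw [abs_le]
    constructor
    · linarith [hS x, le_abs_self B, abs_nonneg (f x)]
    · linarith [hSle x, le_abs_self (f x), abs_nonneg B]
  have h0 : 0 ≤ |f x| * u x + |B| * u x :=
    add_nonneg (mul_nonneg (abs_nonneg _) (hu0 x)) (mul_nonneg (abs_nonneg _) (hu0 x))
  rw [Real.norm_eq_abs, Real.norm_eq_abs, abs_mul, abs_of_nonneg (hu0 x), abs_of_nonneg h0]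
  nlinarith [hu0 x]

omit [T3Space M] [MeasurableSpace M] [BorelSpace M] [g.HasLeviCivita] in
/-- **Cauchy–Schwarz for the inverse metric**: `|g⁻¹(du, dv)| ≤ (|∇u|² + |∇v|²)/2` for a
Riemannian `g`. [folklore] -/
theorem abs_innerDual_mvfderiv_le (hg : g.IsRiemannian) (u v : M → ℝ) (x : M) :
    |g.innerDual x (mvfderiv (𝓡 n) u x).toLinearMap (mvfderiv (𝓡 n) v x).toLinearMap| ≤
      (g.gradSq u x + g.gradSq v x) / 2 := by
  letI := g.riemannianBundle hg
  set α : Module.Dual ℝ (TangentSpace (𝓡 n) x) := (mvfderiv (𝓡 n) u x).toLinearMap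
  set β : Module.Dual ℝ (TangentSpace (𝓡 n) x) := (mvfderiv (𝓡 n) v x).toLinearMap
  have h1 : g.innerDual x α β = g.val x (g.sharp x α) (g.sharp x β) :=
    g.innerDual_eq_val_sharp_sharp x α β
  have h2 : g.gradSq u x = g.val x (g.sharp x α) (g.sharp x α) := by
    rw [PseudoRiemannianMetric.gradSq, PseudoRiemannianMetric.innerDual_eq_val_sharp_sharp]
  have h3 : g.gradSq v x = g.val x (g.sharp x β) (g.sharp x β) := by
    rw [PseudoRiemannianMetric.gradSq, PseudoRiemannianMetric.innerDual_eq_val_sharp_sharp]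
  rw [h1, h2, h3, ← g.inner_eq hg, ← g.inner_eq hg, ← g.inner_eq hg, real_inner_self_eq_norm_sq,
    real_inner_self_eq_norm_sq]
  have hCS := abs_real_inner_le_norm (g.sharp x α) (g.sharp x β)
  nlinarith [sq_nonneg (‖g.sharp x α‖ - ‖g.sharp x β‖), norm_nonneg (g.sharp x α),
    norm_nonneg (g.sharp x β)]

/-- **Clause (ii) of `CarrilloNi2009_shrinkerLSI` reduced to Thm. 3.1** (with the properness of
`f` and a lower bound for `S` standing in for Lemma 2.1 and [Ch]): on a connected gradient
shrinker with proper potential and `S ≥ −B`, for every smooth compatible `ψ` whose density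
`u = (4π)^{-n/2} e^{-ψ}` has bounded second moment, integrable `𝒲`-integrand and integrable
`|∇ψ|² u` (the case in which the printed LSI is not vacuous), the LSI of Thm. 3.1 for `u`,
`∫ (f + c − ψ) u ≤ ∫ |∇(f − ψ)|² u`, gives `c ≤ 𝒲(g, ψ, 1)`. All integrability provisos and the
integration by parts of §4 are discharged here (`integrable_potential_mul_of_secondMoment`,
`abs_innerDual_mvfderiv_le`, `integral_innerDual_mul_density_eq`).
[cite: CarrilloNi2009, Thm. 1.1 (ii) and §4 (derivation of (4.1) from Thm. 3.1)] -/
theorem clause_ii_of_lsi [PreconnectedSpace M] (hg : g.IsRiemannian)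
    (hf : ContMDiff (𝓡 n) 𝓘(ℝ, ℝ) ∞ f)
    (hsol : ∀ (x : M) (X Y : TangentSpace (𝓡 n) x),
      g.ricci x X Y + g.hessian f x X Y = (1 / 2 : ℝ) * g.val x X Y)
    (hnorm : ∀ x : M, g.scalarCurvature x + g.gradSq f x = f x)
    (hprop : ∀ R : ℝ, IsCompact {x | f x ≤ R}) {B : ℝ} (hS : ∀ x, -B ≤ g.scalarCurvature x)
    {ψ : M → ℝ} (hψ : ContMDiff (𝓡 n) 𝓘(ℝ, ℝ) ∞ ψ) (hψc : g.IsEntropyCompatible ψ 1)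
    (h2 : ∃ o : M, Integrable (fun x ↦ (g.riemEDist o x).toReal ^ 2 * entropyDensity n ψ 1 x)
      g.riemVolume)
    (hW : Integrable (fun x ↦ ((g.scalarCurvature x + g.gradSq ψ x) + ψ x - n) *
      entropyDensity n ψ 1 x) g.riemVolume)
    (hgradu : Integrable (fun x ↦ g.gradSq ψ x * entropyDensity n ψ 1 x) g.riemVolume)
    {c : ℝ}
    (hlsi : ∫ x, (f x + c - ψ x) * entropyDensity n ψ 1 x ∂g.riemVolume ≤
      ∫ x, g.gradSq (fun y ↦ f y - ψ y) x * entropyDensity n ψ 1 x ∂g.riemVolume) :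
    c ≤ g.wEntropy g.leviCivita ψ 1 := by
  obtain ⟨o, ho⟩ := h2
  -- `u` is continuous, positive, integrable of unit mass
  have h1 : ∫ x, entropyDensity n ψ 1 x ∂g.riemVolume = 1 := by
    have := hψc
    rw [PseudoRiemannianMetric.isEntropyCompatible_iff, finrank_euclideanSpace_fin] at this
    exact this
  have huI : Integrable (entropyDensity n ψ 1) g.riemVolume := by
    by_contra hni
    rw [integral_undef hni] at h1
    exact zero_ne_one h1
  have hu : Continuous (entropyDensity n ψ 1) :=
    continuous_const.mul (Real.continuous_exp.comp hψ.continuous.neg)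
  have hu0 : ∀ x, 0 ≤ entropyDensity n ψ 1 x := fun x ↦ (entropyDensity_pos n ψ one_pos x).le
  -- `f u`, `S u`
  obtain ⟨hfu, hSu⟩ := integrable_potential_mul_of_secondMoment hg hf hnorm hS hu hu0 huI ho
  -- `ψ u` from the `𝒲`-integrand
  have hψu : Integrable (fun x ↦ ψ x * entropyDensity n ψ 1 x) g.riemVolume := by
    refine ((hW.sub (hSu.add hgradu)).add (huI.const_mul (n : ℝ))).congr
      (Eventually.of_forall fun x ↦ ?_)
    simp only [Pi.add_apply, Pi.sub_apply]
    ring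
  -- the cross term by Cauchy–Schwarz: `|g⁻¹(df, dψ)| u ≤ (|∇f|² + |∇ψ|²) u / 2`, `|∇f|² = f − S`
  have hgradfu : Integrable (fun x ↦ g.gradSq f x * entropyDensity n ψ 1 x) g.riemVolume := by
    refine (hfu.sub hSu).congr (Eventually.of_forall fun x ↦ ?_)
    show f x * entropyDensity n ψ 1 x - g.scalarCurvature x * entropyDensity n ψ 1 x =
      g.gradSq f x * entropyDensity n ψ 1 x
    rw [← sub_mul]
    congr 1
    linarith [hnorm x]
  have hcrossu : Integrable (fun x ↦ g.innerDual x (mvfderiv (𝓡 n) f x).toLinearMap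
      (mvfderiv (𝓡 n) ψ x).toLinearMap * entropyDensity n ψ 1 x) g.riemVolume := by
    have hmeas : Continuous (fun x ↦ g.innerDual x (mvfderiv (𝓡 n) f x).toLinearMap
        (mvfderiv (𝓡 n) ψ x).toLinearMap * entropyDensity n ψ 1 x) :=
      (continuous_innerDual_mvfderiv (g := g) (hf.of_le ENat.LEInfty.out)
        (hψ.of_le ENat.LEInfty.out)).mul hu
    refine (((hgradfu.add hgradu).const_mul (1 / 2))).mono hmeas.aestronglyMeasurable
      (Eventually.of_forall fun x ↦ ?_)
    have hcs := abs_innerDual_mvfderiv_le hg f ψ x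
    have h0 : 0 ≤ 1 / 2 * (g.gradSq f x * entropyDensity n ψ 1 x +
        g.gradSq ψ x * entropyDensity n ψ 1 x) := by
      have := g.gradSq_nonneg hg f x
      have := g.gradSq_nonneg hg ψ x
      have := hu0 x
      positivity
    rw [Real.norm_eq_abs, Real.norm_eq_abs, abs_mul, abs_of_nonneg (hu0 x), Pi.add_apply,
      abs_of_nonneg h0]
    nlinarith [hu0 x]
  exact log_le_wEntropy_of_lsi_of_proper hg hf hsol hnorm hprop hψ hψc hfu hψu hSu hgradu hcrossu
    hlsi

end GrowthFromCurvatureBound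

end CarrilloNi2009_shrinkerLSI

end Literature.Geometry.Riemannian

end
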